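import Literature.NumberTheory.Automorphic.ShimuraCurveRibetTakahashiPeterssonTwistDescentProofs
import Literature.NumberTheory.EllipticCurves.CuspFormLFunctionLevelConductorProofs
import HarnessLib

/-!
# Mai–Murty's bound `(f, f) ≪ N (log N)³` at the levels `64M` and `128M`: the twist-stable
# configuration, where the cusps `u/8` see the newforms of `E^{(2)}` and `E^{(−2)}`

Topic `NumberTheory/Automorphic`; namespace `Literature.NumberTheory.Automorphic` (with dot-notation
lemmas on `WeierstrassCurve` and on `IsNewformOf`). A proofs-only file (theorems and one auxiliary
definition with a body; no named fact, D-0026), continuing the work on the named fact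
`murty_petersson_newform_upper_bound` of `ShimuraCurveRibetTakahashi.lean` (`‖f‖² ≪ N log N`, H. Pasten,
*Shimura curves and the abc conjecture*, arXiv:1705.09251, §16 p. 49, from [MaiMurty1994],
[MurtyCongruencePrimes1999]). What the cited proof establishes — Mai–Murty 1994, §2: `(f, f) ≪ N (log N)³`
by Rankin–Selberg and Rademacher's Phragmén–Lindelöf theorem — is in the tree for squarefree `N`
(`…PeterssonConvexityCubeProofs`), for `N = 2ᵗM` with `M` odd squarefree and `t ≤ 5`
(`…PeterssonTwoPowerLevelProofs`, `…PeterssonTwoPowerLevelTwistProofs`), and — by descent along the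
quadratic twists by `−1, ±2` (`…PeterssonTwistDescentProofs`) — for every such level whose twist orbit
meets a level with `64 ∤`. This file closes the levels `2⁶M` and `2⁷M` entirely:

* **The dichotomy.** For `t = v₂(N) ∈ {6, 7}` either some twist `E^{(d)}`, `d ∈ {−1, 2, −2}`, has
  `64 ∤ N_{E^{(d)}}` (descent), or all four conductors are divisible by `64`, and then by Atkin–Li
  (`N ∣ lcm(N_d, 64)`, `N_d ∣ lcm(N, 64)`, in the tree) **all four newforms have the same level `N`**
  (`IsNewformOf.level_eq_of_sixtyfour_dvd_of_quadraticTwist`) — the twist-stable configuration.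
* **The cusps of type `min(j, t−j) = 3`** (denominators `8m`, resp. `8m` and `16m` at `t = 7`) of
  `Γ₀(2ᵗM)` are reached from `∞` by an Atkin–Lehner involution and `L(c) = w_N (1 −c/N; 0 1) w_N⁻¹` with
  `c/N = k/8`, `k` odd: §3 proves **`f(τ + u/8) = (√2/2)(χ₈(u) g₂(τ) + i χ₈'(u) g₃(τ))`** for the newforms
  `g₂, g₃` of `E^{(2)}, E^{(−2)}` at levels divisible by `4` (`aₙ(g₂) = χ₈(n)aₙ(f)`, `aₙ(g₃) = χ₈'(n)aₙ(f)` at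
  odd `n` — §§1–2, from the local Euler factors, with no hypothesis at `2` — `a_{2n} = 0` for all three,
  and the Gauss sums mod `8`: `e(m/8) = (√2/2)(χ₈(m) + iχ₈'(m))` for odd `m`), hence in the twist-stable
  configuration **`f ∣ L(c) = θ₁χ₈(u) g₂ + θ₂χ₈'(u) g₃`** with CONSTANT `θ₁, θ₂` of modulus `√2/2`
  (`IsNewformOf.exists_slash_lowerSL_of_eighth`; `gᵢ ∣ w_N = ±gᵢ` at the common level).
* **The cross terms cancel** (§5): the period-`N` coefficients on a coset of such a type are those of the
  dilate of `H_k = θ₁χ₈(k)g₂ + θ₂χ₈'(k)g₃`, and `Σ_{k ∈ (ℤ/8)ˣ} |aₙ(H_k)|² = 4|aₙ(f)|²`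
  (`sum_kSet_three_norm_sq_cuspCoeff_eighthComb`: the sign patterns of `(χ₈, χ₈')` on `1, 3, 5, 7` and the
  parallelogram law, i.e. `Σ_k χ₈χ₈'(k) = Σ_k χ₄(k) = 0`), so the Rankin–Selberg trace coefficients at level
  `2ᵗM`, `2 ≤ t ≤ 7`, are the SAME dilate-sum as for `t ≤ 5` (`IsNewformOf.rsCoeff_eq_of_two_pow_mul_seven`),
  with `|A_t(s)| ≤ 32` (`norm_twoFactor_le_thirtytwo`).
* **`exists_petersson_le_mul_log_cube_of_two_pow_mul_seven`** (§6): an absolute `C` with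
  `Re (f, f)_{Γ₀(2ᵗM)} ≤ C·N·(1 + log N)³` for `2 ≤ t ≤ 7`, `M` odd squarefree, given the newforms of `E`,
  `E^{(−1)}`, `E^{(±2)}` at level `2ᵗM` (the Phragmén–Lindelöf assembly of the `t ≤ 5` file verbatim on the
  new dictionary; `C = 2·3⁵·(7/3)⁵·1024·e·4³`).
* **`exists_petersson_le_mul_log_cube_of_not_two_pow_eight_dvd`** (§7, under the Modularity Theorem
  `exists_isNewformOf`, which supplies the newforms of the twists): **the printed-strength bound for EVERY
  elliptic curve over `ℚ` whose conductor has squarefree odd part and `2⁸ ∤ N`**, with the power / `ε` /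
  logarithmic forms and the conductor-phrased forms (`…_of_conductorNorm_not_two_pow_eight_dvd`).

What is NOT here: `v₂(N) = 8` (the cusps `u/16` see the twists of `f` by the characters of conductor `16`,
of order `4`, which carry the nebentypus `χ₈` — newform theory with character, not in the tree); odd `p² ∣ N`;
and the exponent `1` of `log N` of the named fact as stated (open-strength; see its docstring and
`murty_petersson_newform_upper_bound_iff_symmSqLOne`).

## References

* [MaiMurty1994] L. Mai, M. R. Murty, *The Phragmén–Lindelöf theorem and modular elliptic curves*,
  Contemp. Math. 166 (1994), §2 (Proposition: `log (f,f) = O(log N)`, via `L(1, Sym² f) = O((log N)³)`).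
* [PastenShimura2024] H. Pasten, *Shimura curves and the abc conjecture*, J. Number Theory 254 (2024)
  = arXiv:1705.09251, §16 p. 49.
* [AtkinLehner1970] A. O. L. Atkin, J. Lehner, *Hecke operators on `Γ₀(m)`*, Math. Ann. 185 (1970),
  Thm. 3.
* [AtkinLi1978] A. O. L. Atkin, W.-C. W. Li, *Twists of newforms and pseudo-eigenvalues of
  `W`-operators*, Invent. Math. 48 (1978), §3.
* [Rankin1939] R. A. Rankin, *Contributions to the theory of Ramanujan's function `τ(n)` II*,
  Proc. Cambridge Philos. Soc. 35 (1939), §4.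
* [SilvermanAEC2009] J. H. Silverman, *The Arithmetic of Elliptic Curves*, 2nd ed. (2009), X.2 Prop. 2.4,
  X.5 Cor. 5.4, Exercise 10.16 (coefficients of quadratic twists).
* [BreuilConradDiamondTaylor2001] C. Breuil, B. Conrad, F. Diamond, R. Taylor, *On the modularity of
  elliptic curves over `ℚ`*, J. Amer. Math. Soc. 14 (2001), Thm. A.

## Mathlib / tree search

Tree: `cuspRep`, `kSet`, `cuspRepWidth`, `cuspRepDil`, `type_arith`, `exists_slash_rep`,
`IsNewform0.exists_slash_lowerSL`, `IsNewform0.exists_slash_frickeGL_eq_smul`,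
`IsNewform0.exists_slash_atkinLehnerSL_mul`, `tpDinv_mul_mapGL_lowerSL`, `tpDinv_mul_mapGL_of_apply`,
`ySL_apply`, `slash_upperGL_apply`, `slash_translGL_apply`, `norm_sq_qExpansion_coeff_of_eq_dilate`,
`sum_quotient_eq_sum_types`, `rsCoeff_eq_sum`, `traceZeta_eq_of_sum_dilate`, `sum_tpC_mul_cpow_eq`,
`twoFactor`, `IsNewformOf.norm_sum_divisors_mul_LSeries_le_eight_mul`, `exists_norm_J₀_le_uniform`
(`…PeterssonTwoPowerLevelProofs` and the Rankin–Selberg trace files); `exists_slash_rep_of_le_two`,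
`exists_slash_rep_of_lt_two`, `IsNewformOf.norm_cuspCoeff_quadraticTwist_neg_one`
(`…PeterssonTwoPowerLevelTwistProofs`); `IsNewformOf.level_dvd_lcm_sixtyfour_of_quadraticTwist`,
`ratCast_ne_zero_of_mem`, `exists_petersson_le_mul_log_cube_of_exists_isNewformOf`
(`…PeterssonTwistDescentProofs`); `localEulerFactor_quadraticTwist_intCast_of_not_dvd`,
`not_dvd_two_of_prime_ne_two`, `χ₈_ringHomComp_apply_natCast` (`QuadraticTwistTwoLFunctionProofs`);
`ArithmeticFunction.eulerProduct_apply_eq_mul_of_forall`, `ArithmeticFunction.ofPowerSeries_rescale_apply`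
(`QuadraticTwistLFunctionProofs`); `IsNewformOf.level_eq_conductorNorm_of_exists_isNewformOf`
(`CuspFormLFunctionLevelConductorProofs`); `hasSum_cuspCoeff_exp`, `cuspCoeff_add_form`, `cuspCoeff_smul`,
`Literature.Analysis.Complex.rademacher_phragmenLindelof_of_finiteOrder`. Mathlib: `ZMod.χ₈`, `ZMod.χ₈'`,
`ZMod.χ₈_nat_eq_if_mod_eight`, `jacobiSym.at_two`, `jacobiSym.at_neg_two`, `ZMod.intCast_mod`,
`Complex.exp_int_mul_two_pi_mul_I`, `Real.cos_pi_div_four`, `Real.sin_pi_div_four`,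
`parallelogram_law_with_norm`, `Nat.exists_eq_two_pow_mul_odd`, `Nat.lcm_eq_left`.
-/

noncomputable section

open scoped MatrixGroups ModularForm Real NumberTheorySymbols
open Complex CongruenceSubgroup
open Literature.NumberTheory.EllipticCurves.ModularForms

/-! ### 1. `aₙ(E^{(±2)}) = χ(n) aₙ(E)` for odd `n`, unconditionally at `2` -/

namespace WeierstrassCurve

open IsDedekindDomain IsDedekindDomain.HeightOneSpectrum NumberField Rat.HeightOneSpectrum IsLocalRing
  ArithmeticFunction

/-- **`aₙ(E^{(d)}) = ε(n) aₙ(E)` for every ODD `n`**, for `d` divisible by no odd prime and `ε`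
completely multiplicative with `ε(ℓ) = (d/ℓ)` at the odd primes — with NO hypothesis at the place `2`
(an odd `n` sees no local factor at `2`; compare `LFunction_quadraticTwist_intCast_apply_of_forall_not_dvd`,
all `n`, which needs the twist to be additive at `2`). [cite: SilvermanAEC2009, X.5 Cor. 5.4 and Exercise 10.16] -/
theorem LFunction_quadraticTwist_intCast_apply_of_forall_not_dvd_of_odd (W : WeierstrassCurve ℚ)
    [W.IsElliptic] {d : ℤ}
    (hd : ∀ ℓ : ℕ, ℓ.Prime → ℓ ≠ 2 → ¬ (ℓ : ℤ) ∣ d) (ε : ℕ → ℤ) (hε1 : ε 1 = 1)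
    (hεmul : ∀ m n, ε (m * n) = ε m * ε n)
    (hεodd : ∀ ℓ : ℕ, ℓ.Prime → ℓ ≠ 2 → J(d | ℓ) = ε ℓ)
    {n : ℕ} (hn : ¬ 2 ∣ n) : (W.quadraticTwist (d : ℚ)).LFunction n = ε n * W.LFunction n := by
  rw [LFunction_eq_eulerProduct, LFunction_eq_eulerProduct]
  refine ArithmeticFunction.eulerProduct_apply_eq_mul_of_forall (P := fun n ↦ ¬ 2 ∣ n)
    (fun m n h ↦ ⟨fun hm ↦ h (dvd_mul_of_dvd_left hm n), fun hn' ↦ h (dvd_mul_of_dvd_right hn' m)⟩)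
    ε hε1 hεmul _ _ (fun v m hm ↦ ?_) (eventually_cofinite_localEulerFactor_apply _)
    (eventually_cofinite_localEulerFactor_apply _) hn
  haveI := Fact.mk (primesEquiv v).2
  have hℓ1 : 1 < (primesEquiv v : ℕ) := (primesEquiv v).2.one_lt
  by_cases hv2 : (primesEquiv v : ℕ) = 2
  · -- the place over `2`: an odd `m` supported on powers of `2` is `m = 1`
    by_cases hm1 : m = 1
    · subst hm1
      rw [localEulerFactor_apply_one, localEulerFactor_apply_one, hε1, one_mul]
    · have hpow : ¬ ∃ k, Nat.card (ResidueField (v.adicCompletionIntegers ℚ)) ^ k = m := by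
        rw [natCard_residueField_adicCompletionIntegers, hv2]
        rintro ⟨k, rfl⟩
        rcases k with _ | k
        · exact hm1 (pow_zero 2)
        · exact hm (dvd_pow_self 2 k.succ_ne_zero)
      rw [localEulerFactor_apply_eq_zero _ _ (by rwa [natCard_residueField_adicCompletionIntegers]) hpow,
        localEulerFactor_apply_eq_zero _ _ (by rwa [natCard_residueField_adicCompletionIntegers]) hpow,
        mul_zero]
  · -- an odd place: `ℓ ∤ d`
    have hvd : ¬ ((primesEquiv v : ℕ) : ℤ) ∣ d := hd _ (primesEquiv v).2 hv2
    rw [W.localEulerFactor_quadraticTwist_intCast_of_not_dvd d v hv2 hvd, localEulerFactor,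
      natCard_residueField_adicCompletionIntegers, hεodd _ (primesEquiv v).2 hv2]
    exact ArithmeticFunction.ofPowerSeries_rescale_apply hℓ1 ε hε1 hεmul _ m

/-- **`aₙ(E^{(2)}) = χ₈(n) aₙ(E)` for every odd `n`** and every elliptic curve `E/ℚ` (no hypothesis
at `2`; Kronecker character `(8/·) = χ₈`, `(2/ℓ) = χ₈(ℓ)` by `jacobiSym.at_two`).
[cite: SilvermanAEC2009, X.5 Cor. 5.4 and Exercise 10.16] -/
theorem LFunction_quadraticTwist_two_apply_of_odd (W : WeierstrassCurve ℚ) [W.IsElliptic]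
    {n : ℕ} (hn : ¬ 2 ∣ n) : (W.quadraticTwist 2).LFunction n = ZMod.χ₈ n * W.LFunction n := by
  have h := W.LFunction_quadraticTwist_intCast_apply_of_forall_not_dvd_of_odd (d := 2)
    (fun ℓ hℓ hℓ2 ↦ not_dvd_two_of_prime_ne_two hℓ hℓ2) (fun n : ℕ ↦ (ZMod.χ₈ n : ℤ)) (by simp)
    (fun m n ↦ by rw [Nat.cast_mul, map_mul]) (fun ℓ hℓ hℓ2 ↦ ?_) hn
  · rw [show ((2 : ℤ) : ℚ) = 2 by norm_num] at h
    exact_mod_cast h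
  · exact jacobiSym.at_two (hℓ.odd_of_ne_two hℓ2)

/-- **`aₙ(E^{(−2)}) = χ₈'(n) aₙ(E)` for every odd `n`** and every elliptic curve `E/ℚ` (Kronecker
character `(−8/·) = χ₈'`, `(−2/ℓ) = χ₈'(ℓ)` by `jacobiSym.at_neg_two`).
[cite: SilvermanAEC2009, X.5 Cor. 5.4 and Exercise 10.16] -/
theorem LFunction_quadraticTwist_neg_two_apply_of_odd (W : WeierstrassCurve ℚ) [W.IsElliptic]
    {n : ℕ} (hn : ¬ 2 ∣ n) : (W.quadraticTwist (-2)).LFunction n = ZMod.χ₈' n * W.LFunction n := by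
  have h := W.LFunction_quadraticTwist_intCast_apply_of_forall_not_dvd_of_odd (d := -2)
    (fun ℓ hℓ hℓ2 h ↦ not_dvd_two_of_prime_ne_two hℓ hℓ2 (dvd_neg.mp h))
    (fun n : ℕ ↦ (ZMod.χ₈' n : ℤ)) (by simp) (fun m n ↦ by rw [Nat.cast_mul, map_mul])
    (fun ℓ hℓ hℓ2 ↦ ?_) hn
  · rw [show ((-2 : ℤ) : ℚ) = -2 by norm_num] at h
    exact_mod_cast h
  · exact jacobiSym.at_neg_two (hℓ.odd_of_ne_two hℓ2)

end WeierstrassCurve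

namespace Literature.NumberTheory.Automorphic

/-! ### 2. The coefficients of the newforms of `E^{(±2)}` -/

section TwistCoeff

variable {N N' : ℕ} [NeZero N] [NeZero N'] {W : WeierstrassCurve ℚ} [W.IsElliptic]

/-- **`aₙ(g) = χ₈(n) aₙ(f)` for odd `n`**, for the newform `f` of `E` and the newform `g` of `E^{(2)}`
(`IsNewformOf` pins the coefficients to the Dirichlet coefficients of the curves).
[cite: SilvermanAEC2009, X.5 Cor. 5.4 and Exercise 10.16] -/
theorem _root_.Literature.NumberTheory.EllipticCurves.ModularForms.IsNewformOf.cuspCoeff_quadraticTwist_two_of_odd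
    {f : CuspForm (Gamma0 N) 2} {g : CuspForm (Gamma0 N') 2} (hf : IsNewformOf W f)
    (hg : IsNewformOf (W.quadraticTwist 2) g) {n : ℕ} (hn : ¬ 2 ∣ n) :
    cuspCoeff g n = (ZMod.χ₈ n : ℂ) * cuspCoeff f n := by
  rw [hg.2 n, hf.2 n, W.LFunction_quadraticTwist_two_apply_of_odd hn, Int.cast_mul]

/-- **`aₙ(g) = χ₈'(n) aₙ(f)` for odd `n`**, for the newform `f` of `E` and the newform `g` of
`E^{(−2)}`. [cite: SilvermanAEC2009, X.5 Cor. 5.4 and Exercise 10.16] -/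
theorem _root_.Literature.NumberTheory.EllipticCurves.ModularForms.IsNewformOf.cuspCoeff_quadraticTwist_neg_two_of_odd
    {f : CuspForm (Gamma0 N) 2} {g : CuspForm (Gamma0 N') 2} (hf : IsNewformOf W f)
    (hg : IsNewformOf (W.quadraticTwist (-2)) g) {n : ℕ} (hn : ¬ 2 ∣ n) :
    cuspCoeff g n = (ZMod.χ₈' n : ℂ) * cuspCoeff f n := by
  rw [hg.2 n, hf.2 n, W.LFunction_quadraticTwist_neg_two_apply_of_odd hn, Int.cast_mul]

/-- `|χ₈(n)| = |χ₈'(n)| = 1` in `ℂ` for odd `n`. [folklore] -/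
theorem norm_χ₈_eq_one_of_odd {n : ℕ} (hn : ¬ 2 ∣ n) :
    ‖((ZMod.χ₈ n : ℤ) : ℂ)‖ = 1 ∧ ‖((ZMod.χ₈' n : ℤ) : ℂ)‖ = 1 := by
  have h2 : n % 2 ≠ 0 := fun h ↦ hn (Nat.dvd_of_mod_eq_zero h)
  constructor
  · rw [ZMod.χ₈_nat_eq_if_mod_eight, if_neg h2]
    split_ifs <;> simp
  · rw [ZMod.χ₈'_nat_eq_if_mod_eight, if_neg h2]
    split_ifs <;> simp

/-- `|aₙ(g)| = |aₙ(f)|` for all `n`, for the newforms `f` of `E` and `g` of `E^{(2)}` at levels divisible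
by `4` (both vanish at even `n`). [folklore] -/
theorem _root_.Literature.NumberTheory.EllipticCurves.ModularForms.IsNewformOf.norm_cuspCoeff_quadraticTwist_two
    {f : CuspForm (Gamma0 N) 2} {g : CuspForm (Gamma0 N') 2} (hf : IsNewformOf W f)
    (hg : IsNewformOf (W.quadraticTwist 2) g) (h4 : 4 ∣ N) (h4' : 4 ∣ N') (n : ℕ) :
    ‖cuspCoeff g n‖ = ‖cuspCoeff f n‖ := by
  by_cases hn : 2 ∣ n
  · rw [IsNewform0.cuspCoeff_eq_zero_of_two_dvd hf.1 h4 hn,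
      IsNewform0.cuspCoeff_eq_zero_of_two_dvd hg.1 h4' hn]
  · rw [hf.cuspCoeff_quadraticTwist_two_of_odd hg hn, norm_mul, (norm_χ₈_eq_one_of_odd hn).1, one_mul]

/-- `|aₙ(g)| = |aₙ(f)|` for all `n`, for the newforms `f` of `E` and `g` of `E^{(−2)}` at levels
divisible by `4`. [folklore] -/
theorem _root_.Literature.NumberTheory.EllipticCurves.ModularForms.IsNewformOf.norm_cuspCoeff_quadraticTwist_neg_two
    {f : CuspForm (Gamma0 N) 2} {g : CuspForm (Gamma0 N') 2} (hf : IsNewformOf W f)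
    (hg : IsNewformOf (W.quadraticTwist (-2)) g) (h4 : 4 ∣ N) (h4' : 4 ∣ N') (n : ℕ) :
    ‖cuspCoeff g n‖ = ‖cuspCoeff f n‖ := by
  by_cases hn : 2 ∣ n
  · rw [IsNewform0.cuspCoeff_eq_zero_of_two_dvd hf.1 h4 hn,
      IsNewform0.cuspCoeff_eq_zero_of_two_dvd hg.1 h4' hn]
  · rw [hf.cuspCoeff_quadraticTwist_neg_two_of_odd hg hn, norm_mul, (norm_χ₈_eq_one_of_odd hn).2,
      one_mul]

end TwistCoeff

/-! ### 3. Eighth roots of unity against `χ₈`, `χ₈'`, and `f(τ + u/8)` -/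

section Eighth

/-- `e^{πi/4} = (√2/2)(1 + i)`. [folklore] -/
theorem exp_pi_div_four_mul_I :
    Complex.exp ((Real.pi : ℂ) / 4 * I) = ((Real.sqrt 2 / 2 : ℝ) : ℂ) * (1 + I) := by
  rw [show (Real.pi : ℂ) / 4 * I = ((Real.pi / 4 : ℝ) : ℂ) * I by push_cast; ring, Complex.exp_mul_I,
    ← Complex.ofReal_cos, ← Complex.ofReal_sin, Real.cos_pi_div_four, Real.sin_pi_div_four]
  ring

/-- The character values packaged: `χ₈`, `χ₈'` at an integer, in `ℂ`. [folklore] -/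
theorem χ₈_intCast_eq_of_emod {m r : ℤ} (h : m % 8 = r) :
    ((ZMod.χ₈ (m : ZMod 8) : ℤ) : ℂ) = ((ZMod.χ₈ (r : ZMod 8) : ℤ) : ℂ) ∧
      ((ZMod.χ₈' (m : ZMod 8) : ℤ) : ℂ) = ((ZMod.χ₈' (r : ZMod 8) : ℤ) : ℂ) := by
  have : (m : ZMod 8) = (r : ZMod 8) := by
    rw [← h]
    exact_mod_cast (ZMod.intCast_mod m 8).symm
  rw [this]
  exact ⟨rfl, rfl⟩

/-- **`e(m/8) = (√2/2)(χ₈(m) + i χ₈'(m))` for odd `m ∈ ℤ`** (Gauss sums mod `8`: only the two primitive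
characters `χ₈`, `χ₈'` see the odd eighth roots of unity). [folklore] -/
theorem exp_two_pi_I_mul_div_eight_of_odd {m : ℤ} (hm : Odd m) :
    Complex.exp (2 * Real.pi * I * m / 8) =
      ((Real.sqrt 2 / 2 : ℝ) : ℂ) * (((ZMod.χ₈ (m : ZMod 8) : ℤ) : ℂ) + I * ((ZMod.χ₈' (m : ZMod 8) : ℤ) : ℂ)) := by
  obtain ⟨r, hr⟩ : ∃ r : ℤ, r = m % 8 := ⟨_, rfl⟩
  obtain ⟨q, hq⟩ : ∃ q : ℤ, q = m / 8 := ⟨_, rfl⟩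
  have hmqr : m = 8 * q + r := by omega
  have hrodd : r % 2 = 1 := by
    have := Int.odd_iff.mp hm
    omega
  have hcases : r = 1 ∨ r = 3 ∨ r = 5 ∨ r = 7 := by omega
  obtain ⟨h1, h2⟩ := χ₈_intCast_eq_of_emod hr.symm
  rw [h1, h2]
  have hexp : Complex.exp (2 * Real.pi * I * m / 8) = Complex.exp (2 * Real.pi * I * r / 8) := by
    rw [hmqr]
    push_cast
    rw [show 2 * (Real.pi : ℂ) * I * (8 * (q : ℂ) + r) / 8 = q * (2 * Real.pi * I) + 2 * Real.pi * I * r / 8 by ring,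
      Complex.exp_add, Complex.exp_int_mul_two_pi_mul_I, one_mul]
  rw [hexp]
  have e8 := exp_pi_div_four_mul_I
  rcases hcases with rfl | rfl | rfl | rfl
  · have hχ₁ : ZMod.χ₈ ((1 : ℤ) : ZMod 8) = 1 := by decide
    have hχ₂ : ZMod.χ₈' ((1 : ℤ) : ZMod 8) = 1 := by decide
    rw [hχ₁, hχ₂, show 2 * (Real.pi : ℂ) * I * ((1 : ℤ) : ℂ) / 8 = (Real.pi : ℂ) / 4 * I by push_cast; ring, e8]
    push_cast
    ring
  · have hχ₁ : ZMod.χ₈ ((3 : ℤ) : ZMod 8) = -1 := by decide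
    have hχ₂ : ZMod.χ₈' ((3 : ℤ) : ZMod 8) = 1 := by decide
    rw [hχ₁, hχ₂, show 2 * (Real.pi : ℂ) * I * ((3 : ℤ) : ℂ) / 8 = (Real.pi : ℂ) / 2 * I + (Real.pi : ℂ) / 4 * I by
      push_cast; ring, Complex.exp_add, Complex.exp_pi_div_two_mul_I, e8]
    push_cast
    linear_combination (((Real.sqrt 2 : ℝ) : ℂ) / 2) * Complex.I_sq
  · have hχ₁ : ZMod.χ₈ ((5 : ℤ) : ZMod 8) = -1 := by decide
    have hχ₂ : ZMod.χ₈' ((5 : ℤ) : ZMod 8) = -1 := by decide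
    rw [hχ₁, hχ₂, show 2 * (Real.pi : ℂ) * I * ((5 : ℤ) : ℂ) / 8 = (Real.pi : ℂ) * I + (Real.pi : ℂ) / 4 * I by
      push_cast; ring, Complex.exp_add, Complex.exp_pi_mul_I, e8]
    push_cast
    ring
  · have hχ₁ : ZMod.χ₈ ((7 : ℤ) : ZMod 8) = 1 := by decide
    have hχ₂ : ZMod.χ₈' ((7 : ℤ) : ZMod 8) = -1 := by decide
    rw [hχ₁, hχ₂, show 2 * (Real.pi : ℂ) * I * ((7 : ℤ) : ℂ) / 8 =
        (Real.pi : ℂ) * I + (Real.pi : ℂ) / 2 * I + (Real.pi : ℂ) / 4 * I by push_cast; ring,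
      Complex.exp_add, Complex.exp_add, Complex.exp_pi_mul_I, Complex.exp_pi_div_two_mul_I, e8]
    push_cast
    linear_combination (-(((Real.sqrt 2 : ℝ) : ℂ) / 2)) * Complex.I_sq

end Eighth


section EighthTranslate

open Matrix.SpecialLinearGroup ModularForm
open UpperHalfPlane hiding I

variable {N N₂ N₃ : ℕ} [NeZero N] [NeZero N₂] [NeZero N₃] {W : WeierstrassCurve ℚ} [W.IsElliptic]

/-- `χ₈(nu) = χ₈(n)χ₈(u)`, `χ₈'(nu) = χ₈'(n)χ₈'(u)` in `ℂ` (`n ∈ ℕ`, `u ∈ ℤ`). [folklore] -/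
theorem χ₈_natCast_mul_intCast (n : ℕ) (u : ℤ) :
    ((ZMod.χ₈ (((n : ℤ) * u : ℤ) : ZMod 8) : ℤ) : ℂ) = ((ZMod.χ₈ (n : ZMod 8) : ℤ) : ℂ) * ((ZMod.χ₈ (u : ZMod 8) : ℤ) : ℂ) ∧
      ((ZMod.χ₈' (((n : ℤ) * u : ℤ) : ZMod 8) : ℤ) : ℂ) = ((ZMod.χ₈' (n : ZMod 8) : ℤ) : ℂ) * ((ZMod.χ₈' (u : ZMod 8) : ℤ) : ℂ) := by
  constructor
  · push_cast
    rw [map_mul, Int.cast_mul]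
  · push_cast
    rw [map_mul, Int.cast_mul]

/-- The phase of the `n`-th term of `f(τ + u/8)`, odd `n`, `u`:
`e(n(u/8 + z)) = (√2/2)(χ₈(n)χ₈(u) + i χ₈'(n)χ₈'(u)) e(nz)`. [folklore] -/
theorem exp_two_pi_I_mul_eighth_vadd {n : ℕ} (hn : ¬ 2 ∣ n) {u : ℤ} (hu : Odd u) (z : ℂ) :
    Complex.exp (2 * Real.pi * I * n * (((((u : ℚ) / 8 : ℚ)) : ℝ) + z)) =
      ((Real.sqrt 2 / 2 : ℝ) : ℂ) * (((ZMod.χ₈ (n : ZMod 8) : ℤ) : ℂ) * ((ZMod.χ₈ (u : ZMod 8) : ℤ) : ℂ) +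
        I * (((ZMod.χ₈' (n : ZMod 8) : ℤ) : ℂ) * ((ZMod.χ₈' (u : ZMod 8) : ℤ) : ℂ))) *
        Complex.exp (2 * Real.pi * I * n * z) := by
  have hodd : Odd ((n : ℤ) * u) := by
    have hn' : Odd (n : ℤ) := by
      have : Odd n := Nat.odd_iff.mpr (by omega)
      exact_mod_cast this
    exact hn'.mul hu
  have h := exp_two_pi_I_mul_div_eight_of_odd hodd
  obtain ⟨h1, h2⟩ := χ₈_natCast_mul_intCast n u
  rw [h1, h2] at h
  rw [mul_add, Complex.exp_add, ← h]
  congr 1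
  push_cast
  ring

/-- **`f(τ + u/8) = (√2/2)(χ₈(u) g₂(τ) + i χ₈'(u) g₃(τ))`** (`u` odd) for the newform `f` of `E` and the
newforms `g₂`, `g₃` of `E^{(2)}`, `E^{(−2)}`, all at levels divisible by `4` (so that the even-indexed
coefficients of the three forms vanish): `aₙ(g₂) = χ₈(n)aₙ(f)`, `aₙ(g₃) = χ₈'(n)aₙ(f)` at odd `n` and
`e(n u/8) = (√2/2)(χ₈(nu) + iχ₈'(nu))` — the Gauss sums of the two primitive characters mod `8`.
[folklore] -/
theorem _root_.Literature.NumberTheory.EllipticCurves.ModularForms.IsNewformOf.apply_eighth_vadd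
    {f : CuspForm (Gamma0 N) 2} {g₂ : CuspForm (Gamma0 N₂) 2} {g₃ : CuspForm (Gamma0 N₃) 2}
    (hf : IsNewformOf W f) (hg₂ : IsNewformOf (W.quadraticTwist 2) g₂)
    (hg₃ : IsNewformOf (W.quadraticTwist (-2)) g₃) (h4 : 4 ∣ N) (h4₂ : 4 ∣ N₂) (h4₃ : 4 ∣ N₃)
    {u : ℤ} (hu : Odd u) (τ : ℍ) :
    f (((((u : ℚ) / 8 : ℚ)) : ℝ) +ᵥ τ) =
      ((Real.sqrt 2 / 2 : ℝ) : ℂ) * (((ZMod.χ₈ (u : ZMod 8) : ℤ) : ℂ) * g₂ τ +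
        I * ((ZMod.χ₈' (u : ZMod 8) : ℤ) : ℂ) * g₃ τ) := by
  set c : ℂ := ((Real.sqrt 2 / 2 : ℝ) : ℂ) with hc
  set x₂ : ℂ := ((ZMod.χ₈ (u : ZMod 8) : ℤ) : ℂ) with hx₂
  set x₃ : ℂ := ((ZMod.χ₈' (u : ZMod 8) : ℤ) : ℂ) with hx₃
  have h1 := hasSum_cuspCoeff_exp f (((((u : ℚ) / 8 : ℚ)) : ℝ) +ᵥ τ)
  have h2 := ((hasSum_cuspCoeff_exp g₂ τ).mul_left (c * x₂)).add
    ((hasSum_cuspCoeff_exp g₃ τ).mul_left (c * (I * x₃)))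
  have h2' : HasSum (fun m : ℕ ↦ c * x₂ * (cuspCoeff g₂ m * Complex.exp (2 * Real.pi * I * m * τ)) +
      c * (I * x₃) * (cuspCoeff g₃ m * Complex.exp (2 * Real.pi * I * m * τ)))
      (c * (x₂ * g₂ τ + I * x₃ * g₃ τ)) := by
    have e : c * x₂ * g₂ τ + c * (I * x₃) * g₃ τ = c * (x₂ * g₂ τ + I * x₃ * g₃ τ) := by ring
    rw [← e]
    exact h2
  refine HasSum.unique ?_ h2'
  refine h1.congr_fun fun n ↦ ?_
  by_cases hn : 2 ∣ n
  · rw [IsNewform0.cuspCoeff_eq_zero_of_two_dvd hf.1 h4 hn, IsNewform0.cuspCoeff_eq_zero_of_two_dvd hg₂.1 h4₂ hn,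
      IsNewform0.cuspCoeff_eq_zero_of_two_dvd hg₃.1 h4₃ hn]
    simp
  · rw [UpperHalfPlane.coe_vadd, exp_two_pi_I_mul_eighth_vadd hn hu,
      hf.cuspCoeff_quadraticTwist_two_of_odd hg₂ hn, hf.cuspCoeff_quadraticTwist_neg_two_of_odd hg₃ hn]
    simp only [hc, hx₂, hx₃]
    push_cast
    ring

/-- **`f ∣[2] (1 u/8; 0 1) = (√2/2)χ₈(u) · g₂ + (√2/2) i χ₈'(u) · g₃`** as functions on `ℍ`, `u` odd.
[folklore] -/
theorem _root_.Literature.NumberTheory.EllipticCurves.ModularForms.IsNewformOf.slash_translGL_eighth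
    {f : CuspForm (Gamma0 N) 2} {g₂ : CuspForm (Gamma0 N₂) 2} {g₃ : CuspForm (Gamma0 N₃) 2}
    (hf : IsNewformOf W f) (hg₂ : IsNewformOf (W.quadraticTwist 2) g₂)
    (hg₃ : IsNewformOf (W.quadraticTwist (-2)) g₃) (h4 : 4 ∣ N) (h4₂ : 4 ∣ N₂) (h4₃ : 4 ∣ N₃)
    {u : ℤ} (hu : Odd u) :
    (⇑f : ℍ → ℂ) ∣[(2 : ℤ)] glCast (translGL ((u : ℚ) / 8) : GL (Fin 2) ℚ) =
      (((Real.sqrt 2 / 2 : ℝ) : ℂ) * ((ZMod.χ₈ (u : ZMod 8) : ℤ) : ℂ)) • (⇑g₂ : ℍ → ℂ) +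
        (((Real.sqrt 2 / 2 : ℝ) : ℂ) * I * ((ZMod.χ₈' (u : ZMod 8) : ℤ) : ℂ)) • (⇑g₃ : ℍ → ℂ) := by
  ext τ
  rw [slash_translGL_apply, Pi.add_apply, Pi.smul_apply, Pi.smul_apply, smul_eq_mul, smul_eq_mul,
    hf.apply_eighth_vadd hg₂ hg₃ h4 h4₂ h4₃ hu τ]
  ring

/-- `χ₈(−u) = χ₈(u)` and `χ₈'(−u) = −χ₈'(u)` in `ℂ`. [folklore] -/
theorem χ₈_neg_intCast (u : ℤ) :
    ((ZMod.χ₈ ((-u : ℤ) : ZMod 8) : ℤ) : ℂ) = ((ZMod.χ₈ (u : ZMod 8) : ℤ) : ℂ) ∧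
      ((ZMod.χ₈' ((-u : ℤ) : ZMod 8) : ℤ) : ℂ) = -((ZMod.χ₈' (u : ZMod 8) : ℤ) : ℂ) := by
  have h1 : ZMod.χ₈ (-1) = 1 := by decide
  have h2 : ZMod.χ₈' (-1) = -1 := by decide
  constructor
  · rw [Int.cast_neg, ← neg_one_mul, map_mul, h1, one_mul]
  · rw [Int.cast_neg, ← neg_one_mul ((u : ℤ) : ZMod 8), map_mul, h2, neg_one_mul, Int.cast_neg]

/-- **`f ∣[2] L(c) = θ₁χ₈(u) · g₂ + θ₂χ₈'(u) · g₃` whenever `8c/N = u` is an odd integer**, with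
constants `θ₁, θ₂` (`|θ₁| = |θ₂| = √2/2`) depending only on the three newforms `f, g₂, g₃` of `E`,
`E^{(2)}`, `E^{(−2)}` at the SAME level `N`, `4 ∣ N`: `f ∣ L(c) = ε_f (f ∣ T^{−c/N}) ∣ w_N`, the
eighth-translate is the combination of `g₂, g₃` above, and `gᵢ ∣ w_N = εᵢ gᵢ`.
[cite: AtkinLehner1970, Thm. 3] -/
theorem _root_.Literature.NumberTheory.EllipticCurves.ModularForms.IsNewformOf.exists_slash_lowerSL_of_eighth
    {f g₂ g₃ : CuspForm (Gamma0 N) 2} (hf : IsNewformOf W f) (hg₂ : IsNewformOf (W.quadraticTwist 2) g₂)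
    (hg₃ : IsNewformOf (W.quadraticTwist (-2)) g₃) (h4 : 4 ∣ N) :
    ∃ θ₁ θ₂ : ℂ, ‖θ₁‖ = Real.sqrt 2 / 2 ∧ ‖θ₂‖ = Real.sqrt 2 / 2 ∧ ∀ (c u : ℤ), Odd u → 8 * c = u * N →
      (⇑f : ℍ → ℂ) ∣[(2 : ℤ)] (mapGL ℝ (lowerSL c) : GL (Fin 2) ℝ) =
        (θ₁ * ((ZMod.χ₈ (u : ZMod 8) : ℤ) : ℂ)) • (⇑g₂ : ℍ → ℂ) +
          (θ₂ * ((ZMod.χ₈' (u : ZMod 8) : ℤ) : ℂ)) • (⇑g₃ : ℍ → ℂ) := by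
  obtain ⟨ε, hε, hW, hL⟩ := hf.1.exists_slash_lowerSL
  obtain ⟨ε₂, hε₂, hW₂⟩ := hg₂.1.exists_slash_frickeGL_eq_smul
  obtain ⟨ε₃, hε₃, hW₃⟩ := hg₃.1.exists_slash_frickeGL_eq_smul
  set c₀ : ℂ := ((Real.sqrt 2 / 2 : ℝ) : ℂ) with hc₀
  have hN0 : (N : ℚ) ≠ 0 := by exact_mod_cast NeZero.ne N
  have hε1 : ‖ε‖ = 1 := by rcases hε with rfl | rfl <;> simp
  have hε₂1 : ‖ε₂‖ = 1 := by rcases hε₂ with rfl | rfl <;> simp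
  have hε₃1 : ‖ε₃‖ = 1 := by rcases hε₃ with rfl | rfl <;> simp
  have hc₀n : ‖c₀‖ = Real.sqrt 2 / 2 := by
    rw [hc₀, Complex.norm_real, Real.norm_of_nonneg (by positivity)]
  refine ⟨ε * c₀ * ε₂, -(ε * c₀ * I * ε₃), ?_, ?_, fun c u hu h ↦ ?_⟩
  · rw [norm_mul, norm_mul, hε1, hε₂1, hc₀n, one_mul, mul_one]
  · rw [norm_neg, norm_mul, norm_mul, norm_mul, hε1, hε₃1, hc₀n, Complex.norm_I, one_mul, mul_one, mul_one]
  · have hq : (-(c : ℚ) / N : ℚ) = ((-u : ℤ) : ℚ) / 8 := by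
      have h' : (8 : ℚ) * c = u * N := by exact_mod_cast h
      field_simp
      push_cast
      linarith
    obtain ⟨hn₂, hn₃⟩ := χ₈_neg_intCast u
    rw [hL c, hq, hf.slash_translGL_eighth hg₂ hg₃ h4 h4 h4 hu.neg, hn₂, hn₃, SlashAction.add_slash,
      ModularForm.smul_slash, ModularForm.smul_slash, σ_glCast, σ_glCast, hW₂, hW₃, smul_add, smul_smul,
      smul_smul, smul_smul, smul_smul]
    congr 1
    · congr 1
      ring
    · congr 1
      ring

end EighthTranslate

/-! ### 4. The slash of `f` by a representative, given the slash by the relevant `L(c)` -/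

section RepsGeneral

open Matrix.SpecialLinearGroup ModularForm
open UpperHalfPlane hiding I

variable {t M : ℕ} [NeZero M]

/-- **Family 1, general form**: if `f ∣ L(Q · 2ʲmk) = θ · g` (`Q = M/m`, `|θ| = 1`, `g` a cusp form of any
level), then `(f ∣ β(Q)L(2ʲmk))(τ) = K · g(τ/Q)` with `|K| = D/N` (`2j ≥ t`). The proof of
`exists_slash_rep_of_le` / `exists_slash_rep_of_le_two` with the translate abstracted.
[cite: AtkinLehner1970, Thm. 3] -/
theorem exists_slash_rep_of_le_of_slash_lowerSL (hMo : Odd M) (hMs : Squarefree M) {m j k : ℕ} (hm : m ∣ M)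
    (htj : t ≤ 2 * j) {f : CuspForm (Gamma0 (2 ^ t * M)) 2} (hf : IsNewform0 f)
    {L : ℕ} {g : CuspForm (Gamma0 L) 2} {θ : ℂ} (hθn : ‖θ‖ = 1)
    (hθ : (⇑f : ℍ → ℂ) ∣[(2 : ℤ)]
      (mapGL ℝ (lowerSL (((M / m : ℕ) : ℤ) * ((2 ^ j * m * k : ℕ) : ℤ))) : GL (Fin 2) ℝ) = θ • (⇑g : ℍ → ℂ)) :
    ∃ K : ℂ, ‖K‖ = (cuspRepDil t m j : ℝ) / (2 ^ t * M : ℕ) ∧ ∃ r : ℝ, ∀ τ : ℍ,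
      ((⇑f : ℍ → ℂ) ∣[(2 : ℤ)] (mapGL ℝ (cuspRep t M m j k) : GL (Fin 2) ℝ)) τ =
        K * g (UpperHalfPlane.mk (((cuspRepDil t m j : ℕ) : ℂ) / ((2 ^ t * M : ℕ) : ℕ) * τ + r)
          (im_dilate_pos (dil_pos j (pos_of_dvd hm)) r τ)) := by
  obtain ⟨hm0, hmo, hQo, hcop, hMeq, hNeq⟩ := type_arith t hMo hMs hm
  set Q := M / m with hQdef
  have hQ0 : 0 < Q := Nat.pos_of_ne_zero fun h ↦ by simp [h] at hQo
  haveI : NeZero Q := ⟨hQ0.ne'⟩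
  have hQN : Q ∣ 2 ^ t * M := ⟨2 ^ t * m, by rw [hNeq]; ring⟩
  have hNQ : 2 ^ t * M / Q = 2 ^ t * m := by
    rw [hNeq, Nat.mul_div_cancel _ hQ0]
  have hc : Nat.Coprime Q (2 ^ t * M / Q) := by
    rw [hNQ]
    exact Nat.Coprime.mul_right ((Nat.coprime_two_right.mpr hQo).pow_right t) hcop
  obtain ⟨ε, hε, hAL⟩ := hf.exists_slash_atkinLehnerSL_mul hQN hc
  have hm' : (0 : ℝ) < m := by exact_mod_cast hm0
  have hQr : (0 : ℝ) < Q := by exact_mod_cast hQ0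
  refine ⟨ε * θ / Q, ?_, 0, fun τ ↦ ?_⟩
  · have hε1 : ‖ε‖ = 1 := by rcases hε with rfl | rfl <;> simp
    rw [norm_div, norm_mul, hε1, hθn, Complex.norm_natCast, one_mul]
    simp only [cuspRepDil, if_pos htj]
    rw [hNeq]
    push_cast
    field_simp
  · rw [cuspRep, if_pos htj, hAL, tpDinv_mul_mapGL_lowerSL, SlashAction.slash_mul, hθ,
      ModularForm.smul_slash, σ_glCast, Pi.smul_apply, Pi.smul_apply, slash_upperGL_apply,
      smul_eq_mul, smul_eq_mul]
    have hpt : UpperHalfPlane.mk (((((Q : ℚ)⁻¹ : ℚ) : ℂ) * τ + ((0 : ℚ) : ℂ)) / ((1 : ℚ) : ℂ))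
        (im_upperGL_pos (by positivity) one_pos 0 τ) =
        UpperHalfPlane.mk (((cuspRepDil t m j : ℕ) : ℂ) / ((2 ^ t * M : ℕ) : ℕ) * τ + ((0 : ℝ) : ℂ))
          (im_dilate_pos (dil_pos j (pos_of_dvd hm)) (0 : ℝ) τ) := by
      refine UpperHalfPlane.ext ?_
      show ((((Q : ℚ)⁻¹ : ℚ) : ℂ) * τ + ((0 : ℚ) : ℂ)) / ((1 : ℚ) : ℂ) =
        ((cuspRepDil t m j : ℕ) : ℂ) / ((2 ^ t * M : ℕ) : ℕ) * τ + ((0 : ℝ) : ℂ)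
      simp only [cuspRepDil, if_pos htj]
      rw [hNeq]
      have hQc : (Q : ℂ) ≠ 0 := by exact_mod_cast hQ0.ne'
      have hmc : (m : ℂ) ≠ 0 := by exact_mod_cast hm0.ne'
      push_cast
      field_simp
    rw [hpt]
    have hQc : (Q : ℂ) ≠ 0 := by exact_mod_cast hQ0.ne'
    push_cast
    field_simp

/-- **Family 2, general form**: if `f ∣ L(2^{t−j}Q · mk) = θ · g` (`|θ| = 1`), then
`(f ∣ β(2ᵗQ) Y(j, mk))(τ) = K · g((2ʲ/R)τ + r₀)` with `|K| = D/N` (`2j < t`, `k` odd).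
[cite: AtkinLehner1970, Thm. 3] -/
theorem exists_slash_rep_of_lt_of_slash_lowerSL (hMo : Odd M) (hMs : Squarefree M) {m j k : ℕ} (hm : m ∣ M)
    (htj : 2 * j < t) (hk : Odd k) {f : CuspForm (Gamma0 (2 ^ t * M)) 2} (hf : IsNewform0 f)
    {L : ℕ} {g : CuspForm (Gamma0 L) 2} {θ : ℂ} (hθn : ‖θ‖ = 1)
    (hθ : (⇑f : ℍ → ℂ) ∣[(2 : ℤ)]
      (mapGL ℝ (lowerSL (((2 ^ (t - j) * (M / m) : ℕ) : ℤ) * ((m * k : ℕ) : ℤ))) : GL (Fin 2) ℝ) =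
        θ • (⇑g : ℍ → ℂ)) :
    ∃ K : ℂ, ‖K‖ = (cuspRepDil t m j : ℝ) / (2 ^ t * M : ℕ) ∧ ∃ r : ℝ, ∀ τ : ℍ,
      ((⇑f : ℍ → ℂ) ∣[(2 : ℤ)] (mapGL ℝ (cuspRep t M m j k) : GL (Fin 2) ℝ)) τ =
        K * g (UpperHalfPlane.mk (((cuspRepDil t m j : ℕ) : ℂ) / ((2 ^ t * M : ℕ) : ℕ) * τ + r)
          (im_dilate_pos (dil_pos j (pos_of_dvd hm)) r τ)) := by
  obtain ⟨hm0, hmo, hQo, hcop, hMeq, hNeq⟩ := type_arith t hMo hMs hm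
  have hjt : j ≤ t := by omega
  have htj' : ¬ t ≤ 2 * j := by omega
  set Q := M / m with hQdef
  have hQ0 : 0 < Q := Nat.pos_of_ne_zero fun h ↦ by simp [h] at hQo
  haveI : NeZero Q := ⟨hQ0.ne'⟩
  -- `Q' = 2ᵗ Q = P R`, `P = 2ʲ`, `R = 2^{t-j} Q`
  set P : ℕ := 2 ^ j with hPdef
  set R : ℕ := 2 ^ (t - j) * Q with hRdef
  haveI : NeZero P := ⟨pow_ne_zero j two_ne_zero⟩
  haveI : NeZero R := ⟨mul_ne_zero (pow_ne_zero _ two_ne_zero) hQ0.ne'⟩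
  haveI : NeZero (2 ^ t * Q) := ⟨mul_ne_zero (pow_ne_zero _ two_ne_zero) hQ0.ne'⟩
  have hPR : 2 ^ t * Q = P * R := by
    rw [hPdef, hRdef, ← mul_assoc, ← pow_add, Nat.add_sub_cancel' hjt]
  have hQN : 2 ^ t * Q ∣ 2 ^ t * M := ⟨m, by rw [hNeq]; ring⟩
  have hNQ : 2 ^ t * M / (2 ^ t * Q) = m := by
    rw [hNeq, show 2 ^ t * m * Q = m * (2 ^ t * Q) by ring, Nat.mul_div_cancel _ (NeZero.pos _)]
  have hc : Nat.Coprime (2 ^ t * Q) (2 ^ t * M / (2 ^ t * Q)) := by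
    rw [hNQ]
    exact Nat.Coprime.mul_left ((Nat.coprime_two_left.mpr hmo).pow_left t) hcop
  obtain ⟨ε, hε, hAL⟩ := hf.exists_slash_atkinLehnerSL_mul hQN hc
  -- the matrix `Y`
  have ha : Odd (((m * k : ℕ)) : ℤ) := by exact_mod_cast hmo.mul hk
  obtain ⟨hY00, hY01, hY10, hY11⟩ := ySL_apply (j := j) ha
  have hY00' : (ySL j ((m * k : ℕ) : ℤ)) 0 0 = (P : ℤ) := by rw [hY00, hPdef]; push_cast; ring
  have hm' : (0 : ℝ) < m := by exact_mod_cast hm0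
  have hQr : (0 : ℝ) < Q := by exact_mod_cast hQ0
  refine ⟨ε * θ * P / R, ?_, (P : ℝ) * (qInv j ((m * k : ℕ) : ℤ) : ℝ) / (2 ^ t * Q : ℕ), fun τ ↦ ?_⟩
  · have hε1 : ‖ε‖ = 1 := by rcases hε with rfl | rfl <;> simp
    rw [norm_div, norm_mul, norm_mul, hε1, hθn, Complex.norm_natCast, Complex.norm_natCast, one_mul,
      one_mul]
    simp only [cuspRepDil, if_neg htj']
    rw [hNeq, hRdef, hPdef, show t = (t - j) + j by omega, pow_add, Nat.add_sub_cancel]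
    push_cast
    field_simp
    ring
  · rw [cuspRep, if_neg htj', hAL, tpDinv_mul_mapGL_of_apply P R (2 ^ t * Q) hPR _ hY00', hY10,
      SlashAction.slash_mul, hθ, ModularForm.smul_slash, σ_glCast, Pi.smul_apply, Pi.smul_apply,
      slash_upperGL_apply, smul_eq_mul, smul_eq_mul]
    have hpt : UpperHalfPlane.mk (((((R : ℚ)⁻¹ : ℚ) : ℂ) * τ +
          ((((ySL j ((m * k : ℕ) : ℤ)) 0 1 : ℚ) / (2 ^ t * Q : ℕ) : ℚ) : ℂ)) / (((P : ℚ)⁻¹ : ℚ) : ℂ))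
        (im_upperGL_pos (by positivity) (by positivity) _ τ) =
        UpperHalfPlane.mk (((cuspRepDil t m j : ℕ) : ℂ) / ((2 ^ t * M : ℕ) : ℕ) * τ +
          (((P : ℝ) * (qInv j ((m * k : ℕ) : ℤ) : ℝ) / (2 ^ t * Q : ℕ) : ℝ) : ℂ))
          (im_dilate_pos (dil_pos j (pos_of_dvd hm)) _ τ) := by
      refine UpperHalfPlane.ext ?_
      show ((((R : ℚ)⁻¹ : ℚ) : ℂ) * τ +
          ((((ySL j ((m * k : ℕ) : ℤ)) 0 1 : ℚ) / (2 ^ t * Q : ℕ) : ℚ) : ℂ)) / (((P : ℚ)⁻¹ : ℚ) : ℂ) =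
        ((cuspRepDil t m j : ℕ) : ℂ) / ((2 ^ t * M : ℕ) : ℕ) * τ +
          (((P : ℝ) * (qInv j ((m * k : ℕ) : ℤ) : ℝ) / (2 ^ t * Q : ℕ) : ℝ) : ℂ)
      simp only [cuspRepDil, if_neg htj', hY01]
      rw [hNeq, hRdef, hPdef, show t = (t - j) + j by omega, pow_add, Nat.add_sub_cancel]
      have hQc : (Q : ℂ) ≠ 0 := by exact_mod_cast hQ0.ne'
      have hmc : (m : ℂ) ≠ 0 := by exact_mod_cast hm0.ne'
      push_cast
      field_simp
      ring
    rw [hpt]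
    have hRc : (R : ℂ) ≠ 0 := by exact_mod_cast (NeZero.ne R)
    have hPc : (P : ℂ) ≠ 0 := by exact_mod_cast (NeZero.ne P)
    push_cast
    field_simp

end RepsGeneral


/-! ### 5. The types with `min(j, t−j) ≤ 2` at any `t`, and the types with `min(j, t−j) = 3` -/

section TypesThree

open Matrix.SpecialLinearGroup ModularForm
open UpperHalfPlane hiding I

variable {t M : ℕ} [NeZero M] {W : WeierstrassCurve ℚ} [W.IsElliptic]

/-- **The slash of `f` by every representative of a type with `min(j, t−j) ≤ 2`** (any `t`): a dilate
of `f` (`min ≤ 1`) or of the newform `g` of `E^{(−1)}` at the same level (`min = 2`), with `|K| = D/N`.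
(`exists_slash_rep_five` without its bound on `t`.) [cite: AtkinLehner1970, Thm. 3] -/
theorem exists_slash_rep_of_min_le_two (hMo : Odd M) (hMs : Squarefree M) {m j k : ℕ} (hm : m ∣ M)
    (hj : j ≤ t) (hmin : min j (t - j) ≤ 2) (hk : Odd k) {f g : CuspForm (Gamma0 (2 ^ t * M)) 2}
    (hf : IsNewformOf W f) (hg : IsNewformOf (W.quadraticTwist (-1)) g) :
    ∃ K : ℂ, ‖K‖ = (cuspRepDil t m j : ℝ) / (2 ^ t * M : ℕ) ∧ ∃ r : ℝ,
      (∀ τ : ℍ, ((⇑f : ℍ → ℂ) ∣[(2 : ℤ)] (mapGL ℝ (cuspRep t M m j k) : GL (Fin 2) ℝ)) τ =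
        K * f (UpperHalfPlane.mk (((cuspRepDil t m j : ℕ) : ℂ) / ((2 ^ t * M : ℕ) : ℕ) * τ + r)
          (im_dilate_pos (dil_pos j (pos_of_dvd hm)) r τ))) ∨
      (∀ τ : ℍ, ((⇑f : ℍ → ℂ) ∣[(2 : ℤ)] (mapGL ℝ (cuspRep t M m j k) : GL (Fin 2) ℝ)) τ =
        K * g (UpperHalfPlane.mk (((cuspRepDil t m j : ℕ) : ℂ) / ((2 ^ t * M : ℕ) : ℕ) * τ + r)
          (im_dilate_pos (dil_pos j (pos_of_dvd hm)) r τ))) := by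
  by_cases hsmall : min j (t - j) ≤ 1
  · obtain ⟨K, hK, r, h⟩ := exists_slash_rep hMo hMs hm hj hsmall hk hf.1
    exact ⟨K, hK, r, Or.inl h⟩
  · have hmin2 : min j (t - j) = 2 := by omega
    by_cases htj : t ≤ 2 * j
    · have hj2 : j + 2 = t := by
        rcases le_total j (t - j) with h | h
        · rw [min_eq_left h] at hmin2; omega
        · rw [min_eq_right h] at hmin2; omega
      obtain ⟨K, hK, r, h⟩ := exists_slash_rep_of_le_two hMo hMs hm hj2 htj hk hf hg
      exact ⟨K, hK, r, Or.inr h⟩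
    · have hj2 : j = 2 := by
        rcases le_total j (t - j) with h | h
        · rw [min_eq_left h] at hmin2; omega
        · rw [min_eq_right h] at hmin2; omega
      obtain ⟨K, hK, r, h⟩ := exists_slash_rep_of_lt_two hMo hMs hm (by omega) hj2 hk hf hg
      exact ⟨K, hK, r, Or.inr h⟩

/-- **The period-`N` coefficients on the cosets of a type with `min(j, t−j) ≤ 2`** (any `t ≥ 2`):
`|cₙ(f ∣ cuspRep T^l)|² = 𝟙[D ∣ n](D/N)²|a_{n/D}(f)|²`. [cite: AtkinLehner1970, Thm. 3] -/
theorem norm_sq_coeff_slash_rep_mul_T_zpow_of_min_le_two (hMo : Odd M) (hMs : Squarefree M) (ht2 : 2 ≤ t)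
    {m j k : ℕ} (hm : m ∣ M) (hj : j ≤ t) (hmin : min j (t - j) ≤ 2) (hk : Odd k)
    {f g : CuspForm (Gamma0 (2 ^ t * M)) 2} (hf : IsNewformOf W f)
    (hg : IsNewformOf (W.quadraticTwist (-1)) g) (l : ℤ) (n : ℕ) :
    ‖(qExpansion ((2 ^ t * M : ℕ) : ℝ)
        ((⇑f : ℍ → ℂ) ∣[(2 : ℤ)] (cuspRep t M m j k * ModularGroup.T ^ l))).coeff n‖ ^ 2 =
      if cuspRepDil t m j ∣ n then
        ((cuspRepDil t m j : ℝ) / (2 ^ t * M : ℕ)) ^ 2 * ‖cuspCoeff f (n / cuspRepDil t m j)‖ ^ 2 else 0 := by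
  rw [norm_qExpansion_coeff_slash_mul_T_zpow f _ l n]
  have hF : IsCuspFunction ((2 ^ t * M : ℕ) : ℝ) ((⇑f : ℍ → ℂ) ∣[(2 : ℤ)] cuspRep t M m j k) :=
    isCuspFunction_slash f _
  obtain ⟨K, hK, r, hFg | hFg⟩ := exists_slash_rep_of_min_le_two hMo hMs hm hj hmin hk hf hg
  · have hFg' : ∀ τ : ℍ, ((⇑f : ℍ → ℂ) ∣[(2 : ℤ)] cuspRep t M m j k) τ =
        K * f (UpperHalfPlane.mk (((cuspRepDil t m j : ℕ) : ℂ) / ((2 ^ t * M : ℕ) : ℕ) * τ + r)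
          (im_dilate_pos (dil_pos j (pos_of_dvd hm)) r τ)) := fun τ ↦ by
      rw [ModularForm.SL_slash]; exact hFg τ
    have h := norm_sq_qExpansion_coeff_of_eq_dilate f hF K (dil_pos j (pos_of_dvd hm)) (dil_dvd j hm) r
      hFg' n
    rw [hK] at h
    exact_mod_cast h
  · have hFg' : ∀ τ : ℍ, ((⇑f : ℍ → ℂ) ∣[(2 : ℤ)] cuspRep t M m j k) τ =
        K * g (UpperHalfPlane.mk (((cuspRepDil t m j : ℕ) : ℂ) / ((2 ^ t * M : ℕ) : ℕ) * τ + r)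
          (im_dilate_pos (dil_pos j (pos_of_dvd hm)) r τ)) := fun τ ↦ by
      rw [ModularForm.SL_slash]; exact hFg τ
    have h := norm_sq_qExpansion_coeff_of_eq_dilate g hF K (dil_pos j (pos_of_dvd hm)) (dil_dvd j hm) r
      hFg' n
    have h4 : 4 ∣ 2 ^ t * M := four_dvd_of_two_le ht2
    rw [hK, hf.norm_cuspCoeff_quadraticTwist_neg_one hg h4 h4] at h
    exact_mod_cast h

/-- The two-term combination of the twisted newforms seen at a cusp of type `min(j, t−j) = 3` and unit
`k`, `H_k = θ₁χ₈(k) · g₂ + θ₂χ₈'(k) · g₃`, as a function. [folklore] -/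
theorem coe_eighthComb {N : ℕ} (g₂ g₃ : CuspForm (Gamma0 N) 2) (θ₁ θ₂ : ℂ) (k : ℕ) :
    (⇑((θ₁ * ((ZMod.χ₈ ((k : ℤ) : ZMod 8) : ℤ) : ℂ)) • g₂ + (θ₂ * ((ZMod.χ₈' ((k : ℤ) : ZMod 8) : ℤ) : ℂ)) • g₃)
        : ℍ → ℂ) =
      (θ₁ * ((ZMod.χ₈ ((k : ℤ) : ZMod 8) : ℤ) : ℂ)) • (⇑g₂ : ℍ → ℂ) +
        (θ₂ * ((ZMod.χ₈' ((k : ℤ) : ZMod 8) : ℤ) : ℂ)) • (⇑g₃ : ℍ → ℂ) := by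
  rw [CuspForm.coe_add, CuspForm.IsGLPos.coe_smul, CuspForm.IsGLPos.coe_smul]

/-- The coefficients of `H_k = θ₁χ₈(k) · g₂ + θ₂χ₈'(k) · g₃`. [folklore] -/
theorem cuspCoeff_eighthComb {N : ℕ} (g₂ g₃ : CuspForm (Gamma0 N) 2) (θ₁ θ₂ : ℂ) (k n : ℕ) :
    cuspCoeff ((θ₁ * ((ZMod.χ₈ ((k : ℤ) : ZMod 8) : ℤ) : ℂ)) • g₂ +
        (θ₂ * ((ZMod.χ₈' ((k : ℤ) : ZMod 8) : ℤ) : ℂ)) • g₃) n =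
      θ₁ * ((ZMod.χ₈ ((k : ℤ) : ZMod 8) : ℤ) : ℂ) * cuspCoeff g₂ n +
        θ₂ * ((ZMod.χ₈' ((k : ℤ) : ZMod 8) : ℤ) : ℂ) * cuspCoeff g₃ n := by
  have hΓ : (1 : ℝ) ∈ (Gamma0 N : Subgroup (GL (Fin 2) ℝ)).strictPeriods :=
    strictWidthInfty_Gamma0 N ▸ Subgroup.strictWidthInfty_mem_strictPeriods _
  rw [cuspCoeff_add_form hΓ, cuspCoeff_smul, cuspCoeff_smul]

omit [NeZero M] in
/-- `kSet 3 = {1, 3, 5, 7}`. [folklore] -/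
theorem kSet_three : kSet 3 = {1, 3, 5, 7} := by decide

/-- **The cross terms cancel over the units mod `8`**: for `x, y ∈ ℂ`,
`Σ_{k ∈ {1,3,5,7}} |χ₈(k) x + χ₈'(k) y|² = 4(|x|² + |y|²)` (the sign patterns `(1,1), (−1,1), (−1,−1),
(1,−1)` and the parallelogram law; equivalently `Σ_k χ₈χ₈'(k) = Σ_k χ₄(k) = 0`). [folklore] -/
theorem sum_kSet_three_norm_sq (x y : ℂ) :
    ∑ k ∈ kSet 3, ‖((ZMod.χ₈ ((k : ℤ) : ZMod 8) : ℤ) : ℂ) * x + ((ZMod.χ₈' ((k : ℤ) : ZMod 8) : ℤ) : ℂ) * y‖ ^ 2 =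
      4 * (‖x‖ ^ 2 + ‖y‖ ^ 2) := by
  have h1 : ZMod.χ₈ (1 : ZMod 8) = 1 := by decide
  have h1' : ZMod.χ₈' (1 : ZMod 8) = 1 := by decide
  have h3 : ZMod.χ₈ ((3 : ℤ) : ZMod 8) = -1 := by decide
  have h3' : ZMod.χ₈' ((3 : ℤ) : ZMod 8) = 1 := by decide
  have h5 : ZMod.χ₈ ((5 : ℤ) : ZMod 8) = -1 := by decide
  have h5' : ZMod.χ₈' ((5 : ℤ) : ZMod 8) = -1 := by decide
  have h7 : ZMod.χ₈ ((7 : ℤ) : ZMod 8) = 1 := by decide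
  have h7' : ZMod.χ₈' ((7 : ℤ) : ZMod 8) = -1 := by decide
  rw [kSet_three, Finset.sum_insert (by decide), Finset.sum_insert (by decide), Finset.sum_insert (by decide),
    Finset.sum_singleton]
  simp only [Nat.cast_one, Nat.cast_ofNat, Int.cast_one, h1, h1', h3, h3', h5, h5', h7, h7', Int.cast_neg,
    one_mul, neg_one_mul]
  have P := parallelogram_law_with_norm ℂ x y
  have e1 : ‖-x + y‖ = ‖x - y‖ := by rw [← norm_neg]; congr 1; ring
  have e2 : ‖-x + -y‖ = ‖x + y‖ := by rw [← norm_neg]; congr 1; ring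
  have e3 : ‖x + -y‖ = ‖x - y‖ := by rw [← sub_eq_add_neg]
  rw [e1, e2, e3]
  nlinarith [P]

/-- **`Σ_{k ∈ kSet 3} |aₙ(H_k)|² = 4 |aₙ(f)|²`** when `|θ₁| = |θ₂| = √2/2` and `|aₙ(g₂)| = |aₙ(g₃)| = |aₙ(f)|`.
[folklore] -/
theorem sum_kSet_three_norm_sq_cuspCoeff_eighthComb {N : ℕ} (f g₂ g₃ : CuspForm (Gamma0 N) 2) {θ₁ θ₂ : ℂ}
    (hθ₁ : ‖θ₁‖ = Real.sqrt 2 / 2) (hθ₂ : ‖θ₂‖ = Real.sqrt 2 / 2) (n : ℕ)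
    (h₂ : ‖cuspCoeff g₂ n‖ = ‖cuspCoeff f n‖) (h₃ : ‖cuspCoeff g₃ n‖ = ‖cuspCoeff f n‖) :
    ∑ k ∈ kSet 3, ‖cuspCoeff (((θ₁ * ((ZMod.χ₈ ((k : ℤ) : ZMod 8) : ℤ) : ℂ)) • g₂ +
          (θ₂ * ((ZMod.χ₈' ((k : ℤ) : ZMod 8) : ℤ) : ℂ)) • g₃)) n‖ ^ 2 = 4 * ‖cuspCoeff f n‖ ^ 2 := by
  have hre : ∀ k : ℕ, cuspCoeff (((θ₁ * ((ZMod.χ₈ ((k : ℤ) : ZMod 8) : ℤ) : ℂ)) • g₂ +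
          (θ₂ * ((ZMod.χ₈' ((k : ℤ) : ZMod 8) : ℤ) : ℂ)) • g₃)) n =
      ((ZMod.χ₈ ((k : ℤ) : ZMod 8) : ℤ) : ℂ) * (θ₁ * cuspCoeff g₂ n) +
        ((ZMod.χ₈' ((k : ℤ) : ZMod 8) : ℤ) : ℂ) * (θ₂ * cuspCoeff g₃ n) := by
    intro k
    rw [cuspCoeff_eighthComb]
    ring
  simp_rw [hre]
  rw [sum_kSet_three_norm_sq, norm_mul, norm_mul, hθ₁, hθ₂, h₂, h₃]
  have hs : (Real.sqrt 2 / 2) ^ 2 = 1 / 2 := by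
    rw [div_pow, Real.sq_sqrt (by norm_num)]; norm_num
  rw [mul_pow, hs]
  ring

/-- **The period-`N` coefficients on the cosets of a type with `min(j, t−j) = 3`**: given
`f ∣ L(c) = θ₁χ₈(u) g₂ + θ₂χ₈'(u) g₃` whenever `8c = uN` (`u` odd),
`|cₙ(f ∣ cuspRep T^l)|² = 𝟙[D ∣ n](D/N)²|a_{n/D}(H_k)|²` with `H_k = θ₁χ₈(k)g₂ + θ₂χ₈'(k)g₃`.
[cite: AtkinLehner1970, Thm. 3] -/
theorem norm_sq_coeff_slash_rep_mul_T_zpow_three (hMo : Odd M) (hMs : Squarefree M)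
    {m j k : ℕ} (hm : m ∣ M) (hj : j ≤ t) (hmin : min j (t - j) = 3) (hk : Odd k)
    {f g₂ g₃ : CuspForm (Gamma0 (2 ^ t * M)) 2} (hf : IsNewform0 f) {θ₁ θ₂ : ℂ}
    (hL : ∀ (c u : ℤ), Odd u → 8 * c = u * ((2 ^ t * M : ℕ) : ℤ) →
      (⇑f : ℍ → ℂ) ∣[(2 : ℤ)] (mapGL ℝ (lowerSL c) : GL (Fin 2) ℝ) =
        (θ₁ * ((ZMod.χ₈ (u : ZMod 8) : ℤ) : ℂ)) • (⇑g₂ : ℍ → ℂ) +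
          (θ₂ * ((ZMod.χ₈' (u : ZMod 8) : ℤ) : ℂ)) • (⇑g₃ : ℍ → ℂ))
    (l : ℤ) (n : ℕ) :
    ‖(qExpansion ((2 ^ t * M : ℕ) : ℝ)
        ((⇑f : ℍ → ℂ) ∣[(2 : ℤ)] (cuspRep t M m j k * ModularGroup.T ^ l))).coeff n‖ ^ 2 =
      if cuspRepDil t m j ∣ n then
        ((cuspRepDil t m j : ℝ) / (2 ^ t * M : ℕ)) ^ 2 *
          ‖cuspCoeff (((θ₁ * ((ZMod.χ₈ ((k : ℤ) : ZMod 8) : ℤ) : ℂ)) • g₂ +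
          (θ₂ * ((ZMod.χ₈' ((k : ℤ) : ZMod 8) : ℤ) : ℂ)) • g₃)) (n / cuspRepDil t m j)‖ ^ 2 else 0 := by
  obtain ⟨hm0, hmo, hQo, hcop, hMeq, hNeq⟩ := type_arith t hMo hMs hm
  set Q := M / m with hQdef
  set H : CuspForm (Gamma0 (2 ^ t * M)) 2 := ((θ₁ * ((ZMod.χ₈ ((k : ℤ) : ZMod 8) : ℤ) : ℂ)) • g₂ +
          (θ₂ * ((ZMod.χ₈' ((k : ℤ) : ZMod 8) : ℤ) : ℂ)) • g₃) with hHdef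
  have hHk : (θ₁ * ((ZMod.χ₈ (((k : ℕ) : ℤ) : ZMod 8) : ℤ) : ℂ)) • (⇑g₂ : ℍ → ℂ) +
      (θ₂ * ((ZMod.χ₈' (((k : ℕ) : ℤ) : ZMod 8) : ℤ) : ℂ)) • (⇑g₃ : ℍ → ℂ) = (1 : ℂ) • (⇑H : ℍ → ℂ) := by
    rw [one_smul, hHdef, coe_eighthComb]
  have hk' : Odd ((k : ℕ) : ℤ) := by exact_mod_cast hk
  -- the slash by the representative: `K · H((D/N)τ + r)`
  have hrep : ∃ K : ℂ, ‖K‖ = (cuspRepDil t m j : ℝ) / (2 ^ t * M : ℕ) ∧ ∃ r : ℝ, ∀ τ : ℍ,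
      ((⇑f : ℍ → ℂ) ∣[(2 : ℤ)] (mapGL ℝ (cuspRep t M m j k) : GL (Fin 2) ℝ)) τ =
        K * H (UpperHalfPlane.mk (((cuspRepDil t m j : ℕ) : ℂ) / ((2 ^ t * M : ℕ) : ℕ) * τ + r)
          (im_dilate_pos (dil_pos j (pos_of_dvd hm)) r τ)) := by
    by_cases htj : t ≤ 2 * j
    · have hj3 : j + 3 = t := by
        rcases le_total j (t - j) with h | h
        · rw [min_eq_left h] at hmin; omega
        · rw [min_eq_right h] at hmin; omega
      refine exists_slash_rep_of_le_of_slash_lowerSL hMo hMs hm htj hf norm_one ?_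
      rw [← hHk]
      refine hL _ _ hk' ?_
      rw [← hQdef, hMeq, ← hj3, pow_add]
      push_cast
      ring
    · have hj3 : j = 3 := by
        rcases le_total j (t - j) with h | h
        · rw [min_eq_left h] at hmin; omega
        · rw [min_eq_right h] at hmin; omega
      refine exists_slash_rep_of_lt_of_slash_lowerSL hMo hMs hm (by omega) hk hf norm_one ?_
      rw [← hHk]
      refine hL _ _ hk' ?_
      rw [← hQdef, hMeq, hj3, show t = (t - 3) + 3 by omega, pow_add, Nat.add_sub_cancel]
      push_cast
      ring
  obtain ⟨K, hK, r, hFg⟩ := hrep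
  rw [norm_qExpansion_coeff_slash_mul_T_zpow f _ l n]
  have hF : IsCuspFunction ((2 ^ t * M : ℕ) : ℝ) ((⇑f : ℍ → ℂ) ∣[(2 : ℤ)] cuspRep t M m j k) :=
    isCuspFunction_slash f _
  have hFg' : ∀ τ : ℍ, ((⇑f : ℍ → ℂ) ∣[(2 : ℤ)] cuspRep t M m j k) τ =
      K * H (UpperHalfPlane.mk (((cuspRepDil t m j : ℕ) : ℂ) / ((2 ^ t * M : ℕ) : ℕ) * τ + r)
        (im_dilate_pos (dil_pos j (pos_of_dvd hm)) r τ)) := fun τ ↦ by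
    rw [ModularForm.SL_slash]; exact hFg τ
  have h := norm_sq_qExpansion_coeff_of_eq_dilate H hF K (dil_pos j (pos_of_dvd hm)) (dil_dvd j hm) r hFg' n
  rw [hK] at h
  exact_mod_cast h

omit [NeZero M] in
/-- For `t ≤ 7`, `min(j, t−j) ≤ 3`. [folklore] -/
theorem min_le_three_of_le_seven (ht : t ≤ 7) (j : ℕ) : min j (t - j) ≤ 3 := by
  rcases le_total j (t - j) with h | h
  · rw [min_eq_left h]; omega
  · rw [min_eq_right h]; omega

/-- **The coefficients of the Rankin–Selberg trace of the newform of `E` at level `2ᵗM`**, `M` odd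
squarefree, `2 ≤ t ≤ 7`, given the newforms `g₁, g₂, g₃` of `E^{(−1)}, E^{(2)}, E^{(−2)}` at the SAME
level (the twist-stable configuration): the same dilate-sum as for `t ≤ 5`
(`IsNewformOf.rsCoeff_eq_of_two_pow_mul_five`). At the cusps of type `min(j, t−j) = 3` the expansion is
the two-term combination `H_k`, and the cross terms cancel in the sum over `k ∈ (ℤ/8)ˣ`
(`sum_kSet_three_norm_sq_cuspCoeff_eighthComb`). [cite: Rankin1939, §4; AtkinLehner1970, Thm. 3] -/
theorem _root_.Literature.NumberTheory.EllipticCurves.ModularForms.IsNewformOf.rsCoeff_eq_of_two_pow_mul_seven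
    (hMo : Odd M) (hMs : Squarefree M) (ht2 : 2 ≤ t) (ht : t ≤ 7)
    {f g₁ g₂ g₃ : CuspForm (Gamma0 (2 ^ t * M)) 2} (hf : IsNewformOf W f)
    (hg₁ : IsNewformOf (W.quadraticTwist (-1)) g₁) (hg₂ : IsNewformOf (W.quadraticTwist 2) g₂)
    (hg₃ : IsNewformOf (W.quadraticTwist (-2)) g₃) (n : ℕ) :
    rsCoeff (2 ^ t * M) 2 f n = ∑ m ∈ M.divisors, ∑ j ∈ Finset.range (t + 1),
      (((kSet (min j (t - j))).card * cuspRepWidth t M m j : ℕ) : ℝ) *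
        (if cuspRepDil t m j ∣ n then
          ((cuspRepDil t m j : ℝ) / (2 ^ t * M : ℕ)) ^ 2 * ‖cuspCoeff f (n / cuspRepDil t m j)‖ ^ 2 else 0) := by
  classical
  haveI : Fintype (SL(2, ℤ) ⧸ Gamma0 (2 ^ t * M)) := Fintype.ofFinite _
  have h4 : 4 ∣ 2 ^ t * M := four_dvd_of_two_le ht2
  obtain ⟨θ₁, θ₂, hθ₁, hθ₂, hL⟩ := hf.exists_slash_lowerSL_of_eighth hg₂ hg₃ h4
  rw [rsCoeff_eq_sum, sum_quotient_eq_sum_types hMo hMs]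
  refine Finset.sum_congr rfl fun m hm ↦ Finset.sum_congr rfl fun j hj ↦ ?_
  have hmM : m ∣ M := Nat.dvd_of_mem_divisors hm
  have hjt : j ≤ t := by have := Finset.mem_range.mp hj; omega
  by_cases hmin : min j (t - j) ≤ 2
  · have hval : ∀ k ∈ kSet (min j (t - j)), ∀ l ∈ Finset.range (cuspRepWidth t M m j),
        ‖(qExpansion ((2 ^ t * M : ℕ) : ℝ) ((⇑f : ℍ → ℂ) ∣[(2 : ℤ)]
          (Quotient.out (QuotientGroup.mk ((cuspRep t M m j k * ModularGroup.T ^ (l : ℤ))⁻¹) :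
            SL(2, ℤ) ⧸ Gamma0 (2 ^ t * M)))⁻¹)).coeff n‖ ^ 2 =
        if cuspRepDil t m j ∣ n then
          ((cuspRepDil t m j : ℝ) / (2 ^ t * M : ℕ)) ^ 2 * ‖cuspCoeff f (n / cuspRepDil t m j)‖ ^ 2 else 0 := by
      intro k hk l _
      obtain ⟨γ, hγ⟩ := QuotientGroup.mk_out_eq_mul (Gamma0 (2 ^ t * M))
        ((cuspRep t M m j k * ModularGroup.T ^ (l : ℤ))⁻¹)
      rw [hγ, mul_inv_rev, inv_inv, SlashAction.slash_mul, slash_eq_self_of_mem_Gamma0 f (inv_mem γ.2)]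
      exact norm_sq_coeff_slash_rep_mul_T_zpow_of_min_le_two hMo hMs ht2 hmM hjt hmin (odd_of_mem_kSet hk)
        hf hg₁ _ n
    rw [Finset.sum_congr rfl fun k hk ↦ Finset.sum_congr rfl fun l hl ↦ hval k hk l hl]
    simp only [Finset.sum_const, Finset.card_range, nsmul_eq_mul]
    push_cast
    ring
  · have hmin3 : min j (t - j) = 3 := by
      have := min_le_three_of_le_seven ht j
      omega
    rw [hmin3]
    have hval : ∀ k ∈ kSet 3, ∀ l ∈ Finset.range (cuspRepWidth t M m j),
        ‖(qExpansion ((2 ^ t * M : ℕ) : ℝ) ((⇑f : ℍ → ℂ) ∣[(2 : ℤ)]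
          (Quotient.out (QuotientGroup.mk ((cuspRep t M m j k * ModularGroup.T ^ (l : ℤ))⁻¹) :
            SL(2, ℤ) ⧸ Gamma0 (2 ^ t * M)))⁻¹)).coeff n‖ ^ 2 =
        if cuspRepDil t m j ∣ n then
          ((cuspRepDil t m j : ℝ) / (2 ^ t * M : ℕ)) ^ 2 *
            ‖cuspCoeff (((θ₁ * ((ZMod.χ₈ ((k : ℤ) : ZMod 8) : ℤ) : ℂ)) • g₂ +
          (θ₂ * ((ZMod.χ₈' ((k : ℤ) : ZMod 8) : ℤ) : ℂ)) • g₃)) (n / cuspRepDil t m j)‖ ^ 2 else 0 := by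
      intro k hk l _
      obtain ⟨γ, hγ⟩ := QuotientGroup.mk_out_eq_mul (Gamma0 (2 ^ t * M))
        ((cuspRep t M m j k * ModularGroup.T ^ (l : ℤ))⁻¹)
      rw [hγ, mul_inv_rev, inv_inv, SlashAction.slash_mul, slash_eq_self_of_mem_Gamma0 f (inv_mem γ.2)]
      exact norm_sq_coeff_slash_rep_mul_T_zpow_three hMo hMs hmM hjt hmin3 (odd_of_mem_kSet hk) hf.1 hL _ n
    rw [Finset.sum_congr rfl fun k hk ↦ Finset.sum_congr rfl fun l hl ↦ hval k hk l hl]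
    simp only [Finset.sum_const, Finset.card_range, nsmul_eq_mul]
    by_cases hD : cuspRepDil t m j ∣ n
    · simp_rw [if_pos hD]
      rw [← Finset.mul_sum, ← Finset.mul_sum,
        sum_kSet_three_norm_sq_cuspCoeff_eighthComb f g₂ g₃ hθ₁ hθ₂ _
          (hf.norm_cuspCoeff_quadraticTwist_two hg₂ h4 h4 _)
          (hf.norm_cuspCoeff_quadraticTwist_neg_two hg₃ h4 h4 _), card_kSet]
      push_cast
      ring
    · simp_rw [if_neg hD]
      simp

/-- The same in the dilate-sum shape of `LSeries_rsCoeff_eq_of_sum_dilate`. [cite: Rankin1939, §4] -/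
theorem _root_.Literature.NumberTheory.EllipticCurves.ModularForms.IsNewformOf.rsCoeff_eq_sum_tpS_seven
    (hMo : Odd M) (hMs : Squarefree M) (ht2 : 2 ≤ t) (ht : t ≤ 7)
    {f g₁ g₂ g₃ : CuspForm (Gamma0 (2 ^ t * M)) 2} (hf : IsNewformOf W f)
    (hg₁ : IsNewformOf (W.quadraticTwist (-1)) g₁) (hg₂ : IsNewformOf (W.quadraticTwist 2) g₂)
    (hg₃ : IsNewformOf (W.quadraticTwist (-2)) g₃) (n : ℕ) :
    rsCoeff (2 ^ t * M) 2 f n =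
      ∑ x ∈ tpS t M, if dilP t x ∣ n then tpC t M x * ‖cuspCoeff f (n / dilP t x)‖ ^ 2 else 0 := by
  rw [hf.rsCoeff_eq_of_two_pow_mul_seven hMo hMs ht2 ht hg₁ hg₂ hg₃ n, tpS, Finset.sum_product]
  refine Finset.sum_congr rfl fun m _ ↦ Finset.sum_congr rfl fun j _ ↦ ?_
  simp only [tpC, dilP]
  split_ifs
  · ring
  · rw [mul_zero]

omit [NeZero M] in
/-- For `t ≤ 7`, `#kSet(min(j, t−j)) ≤ 4`. [folklore] -/
theorem card_kSet_le_four (ht : t ≤ 7) (j : ℕ) : (kSet (min j (t - j))).card ≤ 4 := by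
  rw [card_kSet]
  have := min_le_three_of_le_seven ht j
  interval_cases (min j (t - j)) <;> decide

omit [NeZero M] in
/-- **`|A_t(s)| ≤ 32`** for `t ≤ 7` and `Re s ≥ 0` (at most `8` terms of modulus `≤ #kSet ≤ 4`). [folklore] -/
theorem norm_twoFactor_le_thirtytwo (ht : t ≤ 7) {s : ℂ} (hs : 0 ≤ s.re) : ‖twoFactor t s‖ ≤ 32 := by
  have hP : ∀ P : ℕ, 0 < P → ‖((P : ℕ) : ℂ) ^ (-s)‖ ≤ 1 := by
    intro P hP
    rw [Complex.norm_natCast_cpow_of_pos hP, Complex.neg_re]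
    exact Real.rpow_le_one_of_one_le_of_nonpos (by exact_mod_cast hP) (by linarith)
  have hterm : ∀ j ∈ Finset.range (t + 1), ‖((kSet (min j (t - j))).card : ℂ) *
      (if t ≤ 2 * j then ((2 ^ t : ℕ) : ℂ) ^ (-s) else ((2 ^ (2 * j) : ℕ) : ℂ) ^ (-s))‖ ≤ 4 := by
    intro j _
    rw [norm_mul, Complex.norm_natCast]
    have h1 : ‖(if t ≤ 2 * j then ((2 ^ t : ℕ) : ℂ) ^ (-s) else ((2 ^ (2 * j) : ℕ) : ℂ) ^ (-s))‖ ≤ 1 := by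
      split_ifs
      · exact hP _ (by positivity)
      · exact hP _ (by positivity)
    have h2 : ((kSet (min j (t - j))).card : ℝ) ≤ 4 := by exact_mod_cast card_kSet_le_four ht j
    calc ((kSet (min j (t - j))).card : ℝ) *
          ‖(if t ≤ 2 * j then ((2 ^ t : ℕ) : ℂ) ^ (-s) else ((2 ^ (2 * j) : ℕ) : ℂ) ^ (-s))‖
        ≤ 4 * 1 := mul_le_mul h2 h1 (norm_nonneg _) (by norm_num)
      _ = 4 := by norm_num
  calc ‖twoFactor t s‖ ≤ ∑ j ∈ Finset.range (t + 1), ‖((kSet (min j (t - j))).card : ℂ) *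
        (if t ≤ 2 * j then ((2 ^ t : ℕ) : ℂ) ^ (-s) else ((2 ^ (2 * j) : ℕ) : ℂ) ^ (-s))‖ :=
        norm_sum_le _ _
    _ ≤ ∑ j ∈ Finset.range (t + 1), (4 : ℝ) := Finset.sum_le_sum hterm
    _ = 4 * (t + 1) := by simp; ring
    _ ≤ 32 := by
        have h7 : (t : ℝ) ≤ 7 := by exact_mod_cast ht
        linarith

end TypesThree


/-! ### 6. Mai–Murty's bound at the levels `2ᵗM`, `2 ≤ t ≤ 7`, in the twist-stable configuration -/

section MainSeven

open _root_.MeasureTheory _root_.Set _root_.Filter _root_.Real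

variable {t M : ℕ} [NeZero M] {W : WeierstrassCurve ℚ} [W.IsElliptic]

set_option maxHeartbeats 1000000 in
/-- **The Petersson norm of the newform of an elliptic curve of conductor `2ᵗM`, `M` odd squarefree,
`2 ≤ t ≤ 7`, is `≪ N (log N)³`** (Mai–Murty's printed exponent `3`), given the newforms `g₁, g₂, g₃` of
the twists `E^{(−1)}, E^{(2)}, E^{(−2)}` at the SAME level (the twist-stable configuration, which by
Atkin–Li is the only one left at `t ∈ {6, 7}` once the twist descent of
`…PeterssonTwistDescentProofs` is taken into account): an absolute `C > 0` with
`Re (f, f)_{Γ₀(N)} ≤ C · N · (1 + log N)³`. The proof of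
`exists_petersson_le_mul_log_cube_of_two_pow_mul_five` verbatim, on the dictionary
`IsNewformOf.rsCoeff_eq_sum_tpS_seven` (the cusps of type `min(j, t−j) = 3` see the combination
`θ₁χ₈(k)g₂ + θ₂χ₈'(k)g₃`, whose squared coefficients summed over `k ∈ (ℤ/8)ˣ` are again `4|aₙ(f)|²`) and
`|A_t(s)| ≤ 32`; `C = 2·3⁵·(7/3)⁵·1024·e·4³`.
[cite: MaiMurty1994, §2 (L(1, Sym² f) = O((log N)³); Proposition: log⟨f,f⟩ = O(log N))] -/
theorem exists_petersson_le_mul_log_cube_of_two_pow_mul_seven :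
    ∃ C : ℝ, 0 < C ∧ ∀ (t M : ℕ) [NeZero M], 2 ≤ t → t ≤ 7 → Odd M → Squarefree M →
      ∀ (W : WeierstrassCurve ℚ) [W.IsElliptic] (f g₁ g₂ g₃ : CuspForm (Gamma0 (2 ^ t * M)) 2),
        IsNewformOf W f → IsNewformOf (W.quadraticTwist (-1)) g₁ → IsNewformOf (W.quadraticTwist 2) g₂ →
        IsNewformOf (W.quadraticTwist (-2)) g₃ →
        (peterssonProduct (Gamma0 (2 ^ t * M)) 2 f f).re ≤
          C * (2 ^ t * M : ℕ) * (1 + Real.log (2 ^ t * M : ℕ)) ^ 3 := by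
  obtain ⟨Q, hQ, hQbd⟩ := exists_norm_J₀_le_uniform
  refine ⟨2 * 3 ^ 5 * (7 / 3) ^ 5 * 1024 * Real.exp 1 * 4 ^ 3, by positivity, ?_⟩
  intro t M _ ht2 ht7 hMo hMs W _ f g₁ g₂ g₃ hf hg₁ hg₂ hg₃
  have hπ := Real.pi_pos
  have hN0 : (0 : ℝ) < ((2 ^ t * M : ℕ) : ℝ) := Nat.cast_pos.mpr (NeZero.pos (2 ^ t * M))
  have hN1 : (1 : ℝ) ≤ ((2 ^ t * M : ℕ) : ℝ) := by exact_mod_cast NeZero.one_le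
  have hlogN : 0 ≤ Real.log ((2 ^ t * M : ℕ) : ℝ) := Real.log_nonneg hN1
  -- the horocycle datum of the trace `G_f` (as in `NewformPeterssonSizeSiegelProofs`)
  have hGc : Continuous (rsTrace (2 ^ t * M) 2 f) := continuous_rsTrace (ModularFormClass.continuous f)
  have hGinv : ∀ (A : SL(2, ℤ)) (τ : UpperHalfPlane), rsTrace (2 ^ t * M) 2 f (A • τ) = rsTrace (2 ^ t * M) 2 f τ :=
    fun A τ ↦ rsTrace_smul f A τ
  have hG0 : ∀ τ, 0 ≤ rsTrace (2 ^ t * M) 2 f τ := fun τ ↦ rsTrace_nonneg _ τ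
  obtain ⟨B, -, hB⟩ := exists_rsTrace_le f
  have hC : ∀ n, 0 ≤ rsCoeff (2 ^ t * M) 2 f n := fun n ↦ rsCoeff_nonneg _ n
  have hC0 : rsCoeff (2 ^ t * M) 2 f 0 = 0 := rsCoeff_zero f
  set a : ℝ := 4 * π / ((2 ^ t * M : ℕ) : ℝ) with hadef
  have ha : 0 < a := by positivity
  have hs : ∀ y : ℝ, 0 < y → Summable fun n : ℕ ↦ rsCoeff (2 ^ t * M) 2 f n * Real.exp (-a * n * y) :=
    fun y hy ↦ summable_rsCoeff_mul_exp_datum f hy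
  have hm : ∀ y : ℝ, 0 < y → ∫ x in (0 : ℝ)..1, rsTrace (2 ^ t * M) 2 f (pt x y) =
      y ^ (2 : ℝ) * ∑' n : ℕ, rsCoeff (2 ^ t * M) 2 f n * Real.exp (-a * n * y) :=
    fun y hy ↦ horocycle_rsTrace_datum f hy
  have hκ : (0 : ℝ) ≤ 2 := by norm_num
  -- `J`, `V`, `Z`
  set J : ℂ → ℂ := fun s ↦ ∫ w in ModularGroup.fd, (rsTrace (2 ^ t * M) 2 f w : ℂ) * completedEisenstein₀ w s
    with hJdef
  set V : ℝ := ∫ w in ModularGroup.fd, rsTrace (2 ^ t * M) 2 f w with hVdef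
  have hVeq : (peterssonProduct (Gamma0 (2 ^ t * M)) 2 f f).re = V :=
    peterssonProduct_self_re_eq_integral_rsTrace f
  have hV0 : 0 ≤ V := setIntegral_nonneg ModularGroup.isClosed_fd.measurableSet fun w _ ↦ hG0 w
  have hJ : Differentiable ℂ J := differentiable_J₀ hGc hGinv hG0 hB hC hC0 ha hκ hs hm
  have hJbd : ∀ s : ℂ, -1 / 2 ≤ s.re → s.re ≤ 7 / 2 → ‖J s‖ ≤ Q * (1 + a⁻¹) ^ 4 * V :=
    fun s h1 h2 ↦ hQbd hGc hGinv hG0 hB hC hC0 ha hs hm h1 h2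
  set Mb : ℝ := Q * (1 + a⁻¹) ^ 4 * V with hMbdef
  have hMb0 : 0 ≤ Mb := by positivity
  set Z : ℂ → ℂ := fun s ↦ s * (s - 1) * J s + (V : ℂ) / 2 with hZdef
  have hZdiff : Differentiable ℂ Z :=
    ((differentiable_id.mul (differentiable_id.sub_const 1)).mul hJ).add_const _
  have hZsymm : ∀ s : ℂ, Z (1 - s) = Z s := by
    intro s
    have hJs : J (1 - s) = J s := J₀_one_sub (fun w ↦ rsTrace (2 ^ t * M) 2 f w) s
    show (1 - s) * (1 - s - 1) * J (1 - s) + (V : ℂ) / 2 = s * (s - 1) * J s + (V : ℂ) / 2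
    rw [hJs]; ring
  have hZone : Z 1 = (V : ℂ) / 2 := by
    show (1 : ℂ) * (1 - 1) * J 1 + (V : ℂ) / 2 = (V : ℂ) / 2
    ring
  -- finite order in the strip `-1/2 ≤ Re s ≤ 3/2`
  have hgrowth : ∀ z : ℂ, -1 / 2 ≤ z.re → z.re ≤ 3 / 2 →
      ‖Z z‖ ≤ (4 * Mb + V / 2) * Real.exp (|z.im| ^ (1 : ℝ)) := by
    intro z hz1 hz2
    rw [Real.rpow_one]
    have hz : ‖z‖ ≤ 2 + |z.im| := by
      have := Complex.norm_le_abs_re_add_abs_im z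
      have : |z.re| ≤ 2 := abs_le.2 ⟨by linarith, by linarith⟩
      linarith
    have hz' : ‖z - 1‖ ≤ 2 + |z.im| := by
      have := Complex.norm_le_abs_re_add_abs_im (z - 1)
      rw [Complex.sub_re, Complex.sub_im, Complex.one_re, Complex.one_im, sub_zero] at this
      have : |z.re - 1| ≤ 2 := abs_le.2 ⟨by linarith, by linarith⟩
      linarith
    have hexp := two_add_sq_le_four_mul_exp (abs_nonneg z.im)
    have h1e : 1 ≤ Real.exp |z.im| := Real.one_le_exp (abs_nonneg _)
    have hVn : ‖(V : ℂ) / 2‖ = V / 2 := by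
      rw [norm_div, Complex.norm_real, Complex.norm_ofNat, Real.norm_of_nonneg hV0]
    calc ‖Z z‖ = ‖z * (z - 1) * J z + (V : ℂ) / 2‖ := rfl
      _ ≤ ‖z * (z - 1) * J z‖ + ‖(V : ℂ) / 2‖ := norm_add_le _ _
      _ = ‖z‖ * ‖z - 1‖ * ‖J z‖ + V / 2 := by rw [norm_mul, norm_mul, hVn]
      _ ≤ (2 + |z.im|) * (2 + |z.im|) * Mb + V / 2 * 1 := by
          rw [mul_one]
          have hJz : ‖J z‖ ≤ Mb := hJbd z hz1 (by linarith)
          have h1 : ‖z‖ * ‖z - 1‖ ≤ (2 + |z.im|) * (2 + |z.im|) :=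
            mul_le_mul hz hz' (norm_nonneg _) (by positivity)
          have h2 : ‖z‖ * ‖z - 1‖ * ‖J z‖ ≤ (2 + |z.im|) * (2 + |z.im|) * Mb :=
            mul_le_mul h1 hJz (norm_nonneg _) (by positivity)
          linarith
      _ ≤ (4 * Real.exp |z.im|) * Mb + V / 2 * Real.exp |z.im| := by
          have h3 : (2 + |z.im|) * (2 + |z.im|) ≤ 4 * Real.exp |z.im| := by rw [← sq]; exact hexp
          have h4 : (2 + |z.im|) * (2 + |z.im|) * Mb ≤ 4 * Real.exp |z.im| * Mb :=
            mul_le_mul_of_nonneg_right h3 hMb0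
          have h5 : V / 2 * 1 ≤ V / 2 * Real.exp |z.im| := mul_le_mul_of_nonneg_left h1e (by linarith)
          linarith
      _ = (4 * Mb + V / 2) * Real.exp |z.im| := by ring
  -- the parameter `δ` and the real zeta value `ζ(1 + δ)`
  set δ : ℝ := 1 / (2 + Real.log ((2 ^ t * M : ℕ) : ℝ)) with hδdef
  have hδ0 : 0 < δ := by positivity
  have hδhalf : δ ≤ 1 / 2 := by
    rw [hδdef]; exact one_div_le_one_div_of_le (by norm_num) (by linarith)
  set ζδ : ℝ := ∑' n : ℕ, 1 / (n : ℝ) ^ (1 + δ) with hζδdef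
  have hζδpos : 0 < ζδ := tsum_one_div_nat_rpow_pos (by linarith)
  have hζδle : ζδ ≤ 4 + Real.log ((2 ^ t * M : ℕ) : ℝ) := by
    have h := tsum_one_div_nat_rpow_le (σ := 1 + δ) (by linarith)
    have hδne : δ ≠ 0 := hδ0.ne'
    have e1 : (1 + δ) / (1 + δ - 1) + 1 = 2 + 1 / δ := by
      rw [show (1 : ℝ) + δ - 1 = δ by ring]; field_simp; ring
    have e2 : 1 / δ = 2 + Real.log ((2 ^ t * M : ℕ) : ℝ) := by rw [hδdef, one_div_one_div]
    linarith
  have hNδ : ((2 ^ t * M : ℕ) : ℝ) ^ δ ≤ Real.exp 1 := by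
    rw [Real.rpow_def_of_pos hN0]
    refine Real.exp_le_exp.2 ?_
    rw [hδdef, mul_one_div]
    exact div_le_one_of_le₀ (by linarith) (by linarith)
  -- the bound on the line `Re s = 1 + δ`
  set A₀ : ℝ := 1024 * (((2 ^ t * M : ℕ) : ℝ) * ((2 ^ t * M : ℕ) : ℝ) ^ δ) * ζδ ^ 3 with hA₀def
  have hA₀pos : 0 < A₀ := by positivity
  have hright : ∀ z : ℂ, z.re = 1 + δ → ‖Z z‖ ≤ A₀ * ‖z + 2‖ ^ 5 := by
    intro z hz
    have hz1 : 1 < z.re := by rw [hz]; linarith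
    have hzne : z ≠ 1 := fun h ↦ by rw [h, Complex.one_re] at hz1; exact lt_irrefl _ hz1
    have hZeq : Z z = z * (z - 1) * ((π : ℂ) ^ (-z) * Complex.Gamma z * riemannZeta (2 * z) *
          (Complex.Gamma (z + 1) * (((4 * π / ((2 ^ t * M : ℕ) : ℝ) : ℝ)) : ℂ) ^ (-(z + 1)))) *
        ((((2 ^ t * M : ℕ) : ℂ)⁻¹ * twoFactor t z * ∑ c ∈ M.divisors, (c : ℂ) ^ (-z)) *
          LSeries (fun n ↦ (((‖cuspCoeff f n‖ ^ 2 : ℝ)) : ℂ)) (z + 1)) := by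
      have h := traceZeta_eq_of_sum_dilate (tpS t M) (tpC t M) (dilP t) (fun i hi ↦ dilP_pos hi) f
        (hf.rsCoeff_eq_sum_tpS_seven hMo hMs ht2 ht7 hg₁ hg₂ hg₃) hz1
      rw [sum_tpC_mul_cpow_eq hMo hMs z] at h
      exact h
    have hZeq' : Z z = z * ((π : ℂ) ^ (-z) * Complex.Gamma z * riemannZeta (2 * z) *
          (Complex.Gamma (z + 1) * (((4 * π / ((2 ^ t * M : ℕ) : ℝ) : ℝ)) : ℂ) ^ (-(z + 1)))) * ((2 ^ t * M : ℕ) : ℂ)⁻¹ *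
        ((z - 1) * (twoFactor t z * ((∑ c ∈ M.divisors, (c : ℂ) ^ (-z)) *
          LSeries (fun n ↦ (((‖cuspCoeff f n‖ ^ 2 : ℝ)) : ℂ)) (z + 1)))) := by
      rw [hZeq]; ring
    -- the factors
    have b1 : ‖z‖ ≤ ‖z + 2‖ := norm_le_norm_add_two (by linarith)
    have b3 : ‖(π : ℂ) ^ (-z)‖ ≤ 1 :=
      norm_ofReal_cpow_neg_le_one (by linarith [Real.pi_gt_three]) (by linarith)
    have b4 : ‖Complex.Gamma z‖ ≤ 1 := norm_Gamma_le_one (by linarith) (by linarith)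
    have b5 : ‖riemannZeta (2 * z)‖ ≤ 2 * ‖z + 2‖ := by
      have h := norm_riemannZeta_two_mul_le (s := z) (by linarith)
      have h3 : (3 : ℝ) ≤ ‖z + 2‖ := by
        have := Complex.re_le_norm (z + 2)
        rw [Complex.add_re, Complex.re_ofNat] at this
        linarith
      linarith
    have b6 : ‖Complex.Gamma (z + 1)‖ ≤ ‖z + 2‖ := by
      have hz0 : z ≠ 0 := fun h ↦ by rw [h, Complex.zero_re] at hz1; linarith
      rw [Complex.Gamma_add_one z hz0, norm_mul]
      calc ‖z‖ * ‖Complex.Gamma z‖ ≤ ‖z + 2‖ * 1 := by gcongr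
        _ = ‖z + 2‖ := mul_one _
    have b7 : ‖(((4 * π / ((2 ^ t * M : ℕ) : ℝ) : ℝ)) : ℂ) ^ (-(z + 1))‖ ≤ ((2 ^ t * M : ℕ) : ℝ) * (((2 ^ t * M : ℕ) : ℝ) * ((2 ^ t * M : ℕ) : ℝ) ^ δ) := by
      have h := norm_cpow_level_le (NeZero.pos (2 ^ t * M)) (s := z) (by linarith)
      rw [hz, Real.rpow_add hN0, Real.rpow_one] at h
      exact h
    have b8 : ‖((2 ^ t * M : ℕ) : ℂ)⁻¹‖ = ((2 ^ t * M : ℕ) : ℝ)⁻¹ := by rw [norm_inv, Complex.norm_natCast]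
    -- the key bound and the pole factor
    have b9 : ‖twoFactor t z * ((∑ c ∈ M.divisors, (c : ℂ) ^ (-z)) *
        LSeries (fun n ↦ (((‖cuspCoeff f n‖ ^ 2 : ℝ)) : ℂ)) (z + 1))‖ ≤ 256 * ζδ ^ 3 * ‖riemannZeta z‖ := by
      rw [norm_mul]
      have h1 : ‖twoFactor t z‖ ≤ 32 := norm_twoFactor_le_thirtytwo ht7 (by linarith)
      have h2 := hf.norm_sum_divisors_mul_LSeries_le_eight_mul hMo hMs ht2 hδ0 hz
      calc ‖twoFactor t z‖ * ‖(∑ c ∈ M.divisors, (c : ℂ) ^ (-z)) *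
            LSeries (fun n ↦ (((‖cuspCoeff f n‖ ^ 2 : ℝ)) : ℂ)) (z + 1)‖
          ≤ 32 * (8 * ζδ ^ 3 * ‖riemannZeta z‖) :=
            mul_le_mul h1 h2 (norm_nonneg _) (by norm_num)
        _ = 256 * ζδ ^ 3 * ‖riemannZeta z‖ := by ring
    have b10 : ‖z - 1‖ * ‖riemannZeta z‖ ≤ 2 * ‖z + 2‖ ^ 2 :=
      norm_sub_one_mul_norm_riemannZeta_le (by linarith) hzne
    have b11 : ‖(z - 1) * (twoFactor t z * ((∑ c ∈ M.divisors, (c : ℂ) ^ (-z)) *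
        LSeries (fun n ↦ (((‖cuspCoeff f n‖ ^ 2 : ℝ)) : ℂ)) (z + 1)))‖ ≤ 512 * ζδ ^ 3 * ‖z + 2‖ ^ 2 := by
      rw [norm_mul]
      calc ‖z - 1‖ * ‖twoFactor t z * ((∑ c ∈ M.divisors, (c : ℂ) ^ (-z)) *
            LSeries (fun n ↦ (((‖cuspCoeff f n‖ ^ 2 : ℝ)) : ℂ)) (z + 1))‖
          ≤ ‖z - 1‖ * (256 * ζδ ^ 3 * ‖riemannZeta z‖) := mul_le_mul_of_nonneg_left b9 (norm_nonneg _)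
        _ = 256 * ζδ ^ 3 * (‖z - 1‖ * ‖riemannZeta z‖) := by ring
        _ ≤ 256 * ζδ ^ 3 * (2 * ‖z + 2‖ ^ 2) := by gcongr
        _ = 512 * ζδ ^ 3 * ‖z + 2‖ ^ 2 := by ring
    calc ‖Z z‖ = ‖z‖ * (‖(π : ℂ) ^ (-z)‖ * ‖Complex.Gamma z‖ * ‖riemannZeta (2 * z)‖ *
          (‖Complex.Gamma (z + 1)‖ * ‖(((4 * π / ((2 ^ t * M : ℕ) : ℝ) : ℝ)) : ℂ) ^ (-(z + 1))‖)) * ‖((2 ^ t * M : ℕ) : ℂ)⁻¹‖ *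
        ‖(z - 1) * (twoFactor t z * ((∑ c ∈ M.divisors, (c : ℂ) ^ (-z)) *
          LSeries (fun n ↦ (((‖cuspCoeff f n‖ ^ 2 : ℝ)) : ℂ)) (z + 1)))‖ := by
          rw [hZeq']; simp only [norm_mul]
      _ ≤ ‖z + 2‖ * (1 * 1 * (2 * ‖z + 2‖) * (‖z + 2‖ * (((2 ^ t * M : ℕ) : ℝ) * (((2 ^ t * M : ℕ) : ℝ) * ((2 ^ t * M : ℕ) : ℝ) ^ δ)))) * ((2 ^ t * M : ℕ) : ℝ)⁻¹ *
        (512 * ζδ ^ 3 * ‖z + 2‖ ^ 2) := by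
          rw [b8]
          gcongr
      _ = A₀ * ‖z + 2‖ ^ 5 := by
          rw [hA₀def]
          field_simp
          ring
  -- the bound on both lines, with `A = (7/3)⁵ A₀`
  set A : ℝ := (7 / 3) ^ 5 * A₀ with hAdef
  have hApos : 0 < A := by positivity
  have hA₀A : A₀ ≤ A := by
    rw [hAdef]
    have : (1 : ℝ) ≤ (7 / 3) ^ 5 := by norm_num
    nlinarith
  have hb : ∀ z : ℂ, z.re = 1 + δ → ‖Z z‖ ≤ A * ‖(2 : ℂ) + z‖ ^ (5 : ℝ) := by
    intro z hz
    rw [show (5 : ℝ) = (5 : ℕ) by norm_num, Real.rpow_natCast, add_comm (2 : ℂ) z]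
    exact (hright z hz).trans (mul_le_mul_of_nonneg_right hA₀A (by positivity))
  have ha' : ∀ z : ℂ, z.re = -δ → ‖Z z‖ ≤ A * ‖(2 : ℂ) + z‖ ^ (5 : ℝ) := by
    intro z hz
    rw [show (5 : ℝ) = (5 : ℕ) by norm_num, Real.rpow_natCast, add_comm (2 : ℂ) z]
    have hsym : Z z = Z (1 - z) := by
      have := hZsymm (1 - z); rwa [sub_sub_cancel] at this
    have h1z : (1 - z).re = 1 + δ := by simp [hz]
    have h := hright (1 - z) h1z
    have h3 : ‖1 - z + 2‖ ≤ 7 / 3 * ‖z + 2‖ := by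
      rw [show (1 : ℂ) - z + 2 = 3 - z by ring]
      exact norm_three_sub_le (by rw [hz]; linarith)
    rw [hsym]
    calc ‖Z (1 - z)‖ ≤ A₀ * ‖1 - z + 2‖ ^ 5 := h
      _ ≤ A₀ * (7 / 3 * ‖z + 2‖) ^ 5 := by gcongr
      _ = A * ‖z + 2‖ ^ 5 := by rw [hAdef]; ring
  -- Phragmén–Lindelöf at `s = 1`
  have hgr : ∀ z : ℂ, -δ < z.re → z.re < 1 + δ →
      ‖Z z‖ ≤ (4 * Mb + V / 2) * Real.exp (|z.im| ^ (1 : ℝ)) :=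
    fun z h1 h2 ↦ hgrowth z (by linarith) (by linarith)
  have hPL := Literature.Analysis.Complex.rademacher_phragmenLindelof_of_finiteOrder (f := Z) (a := -δ) (b := 1 + δ)
    (Q := 2) (A := A) (B := A) (α := 5) (β := 5) (C := 4 * Mb + V / 2) (c := 1)
    (by linarith) (by linarith) hApos hApos le_rfl hZdiff.diffContOnCl one_pos hgr ha' hb
    (z := 1) (by simp; linarith) (by simp; linarith)
  -- `‖Z 1‖ ≤ 243 A`
  have h243 : ‖((2 : ℝ) : ℂ) + 1‖ ^ (5 : ℝ) = 243 := by
    rw [show ((2 : ℝ) : ℂ) + 1 = (3 : ℝ) by push_cast; norm_num, Complex.norm_real,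
      Real.norm_of_nonneg (by norm_num : (0 : ℝ) ≤ 3), show (5 : ℝ) = (5 : ℕ) by norm_num,
      Real.rpow_natCast]
    norm_num
  have hx : 0 < A * 243 := by positivity
  have hZ1 : ‖Z 1‖ ≤ A * 243 := by
    rw [h243, Complex.one_re] at hPL
    have e : (1 + δ - 1) / (1 + δ - -δ) + (1 - -δ) / (1 + δ - -δ) = 1 := by
      rw [← add_div, show (1 : ℝ) + δ - 1 + (1 - -δ) = 1 + δ - -δ by ring,
        div_self (by linarith : (1 : ℝ) + δ - -δ ≠ 0)]
    calc ‖Z 1‖ ≤ (A * 243) ^ ((1 + δ - 1) / (1 + δ - -δ)) * (A * 243) ^ ((1 - -δ) / (1 + δ - -δ)) := hPL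
      _ = A * 243 := by rw [← Real.rpow_add hx, e, Real.rpow_one]
  -- conclusion
  have hV : V / 2 ≤ A * 243 := by
    have : ‖Z 1‖ = V / 2 := by
      rw [hZone, norm_div, Complex.norm_real, Complex.norm_ofNat, Real.norm_of_nonneg hV0]
    rw [← this]; exact hZ1
  rw [hVeq]
  have hζ3 : ζδ ^ 3 ≤ (4 * (1 + Real.log ((2 ^ t * M : ℕ) : ℝ))) ^ 3 :=
    pow_le_pow_left₀ hζδpos.le (by linarith) 3
  calc V ≤ 2 * (A * 243) := by linarith
    _ = 2 * 3 ^ 5 * (7 / 3) ^ 5 * 1024 * (((2 ^ t * M : ℕ) : ℝ) * ((2 ^ t * M : ℕ) : ℝ) ^ δ * ζδ ^ 3) := by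
        rw [hAdef, hA₀def]; ring
    _ ≤ 2 * 3 ^ 5 * (7 / 3) ^ 5 * 1024 * (((2 ^ t * M : ℕ) : ℝ) * Real.exp 1 * (4 * (1 + Real.log ((2 ^ t * M : ℕ) : ℝ))) ^ 3) := by gcongr
    _ = 2 * 3 ^ 5 * (7 / 3) ^ 5 * 1024 * Real.exp 1 * 4 ^ 3 * ((2 ^ t * M : ℕ) : ℝ) * (1 + Real.log ((2 ^ t * M : ℕ) : ℝ)) ^ 3 := by ring

/-- **Power form `(f, f) ≪ N^{1+ε}/ε³`** of `exists_petersson_le_mul_log_cube_of_two_pow_mul_seven`.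
[cite: MaiMurty1994, §2, Proposition] -/
theorem exists_petersson_le_mul_rpow_of_two_pow_mul_seven :
    ∃ C : ℝ, 0 < C ∧ ∀ ε : ℝ, 0 < ε → ε ≤ 1 → ∀ (t M : ℕ) [NeZero M], 2 ≤ t → t ≤ 7 → Odd M → Squarefree M →
      ∀ (W : WeierstrassCurve ℚ) [W.IsElliptic] (f g₁ g₂ g₃ : CuspForm (Gamma0 (2 ^ t * M)) 2),
        IsNewformOf W f → IsNewformOf (W.quadraticTwist (-1)) g₁ → IsNewformOf (W.quadraticTwist 2) g₂ →
        IsNewformOf (W.quadraticTwist (-2)) g₃ →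
        (peterssonProduct (Gamma0 (2 ^ t * M)) 2 f f).re ≤ C * ((2 ^ t * M : ℕ) : ℝ) ^ (1 + ε) / ε ^ 3 := by
  obtain ⟨C, hC, h⟩ := exists_petersson_le_mul_log_cube_of_two_pow_mul_seven
  refine ⟨C * 4 ^ 3, by positivity, fun ε hε hε1 t M _ ht2 ht7 hMo hMs W _ f g₁ g₂ g₃ hf hg₁ hg₂ hg₃ ↦ ?_⟩
  have hN1 : (1 : ℝ) ≤ ((2 ^ t * M : ℕ) : ℝ) := by exact_mod_cast NeZero.one_le (n := 2 ^ t * M)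
  calc (peterssonProduct (Gamma0 (2 ^ t * M)) 2 f f).re
      ≤ C * (2 ^ t * M : ℕ) * (1 + Real.log (2 ^ t * M : ℕ)) ^ 3 :=
        h t M ht2 ht7 hMo hMs W f g₁ g₂ g₃ hf hg₁ hg₂ hg₃
    _ = C * ((2 ^ t * M : ℕ) * (1 + Real.log (2 ^ t * M : ℕ)) ^ 3) := by ring
    _ ≤ C * (4 ^ 3 * ((2 ^ t * M : ℕ) : ℝ) ^ (1 + ε) / ε ^ 3) :=
        mul_le_mul_of_nonneg_left (mul_one_add_log_pow_three_le_rpow hN1 hε hε1) hC.le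
    _ = C * 4 ^ 3 * ((2 ^ t * M : ℕ) : ℝ) ^ (1 + ε) / ε ^ 3 := by ring

end MainSeven

/-! ### 7. Twist-stable levels are equal; the bound for every `256 ∤ N` with squarefree odd part -/

section TwistStable

variable {N N' : ℕ} [NeZero N] [NeZero N'] {W : WeierstrassCurve ℚ} [W.IsElliptic]

/-- **When both levels are divisible by `64`, the newforms of `E` and of its twist by `d ∈ {−1, 2, −2}`
have the SAME level**: `N ∣ lcm(N', 64) = N'` and `N' ∣ lcm(N, 64) = N` (Atkin–Li,
`IsNewformOf.level_dvd_lcm_sixtyfour_of_quadraticTwist`). This is the twist-stable configuration: the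
`2`-adic type of `E` keeps its conductor `2⁶`, `2⁷` or `2⁸` under the three quadratic twists unramified
outside `2`. [cite: AtkinLi1978, §3] -/
theorem _root_.Literature.NumberTheory.EllipticCurves.ModularForms.IsNewformOf.level_eq_of_sixtyfour_dvd_of_quadraticTwist
    {d : ℤ} (hd : d = -1 ∨ d = 2 ∨ d = -2) {f : CuspForm (Gamma0 N) 2} {g : CuspForm (Gamma0 N') 2}
    (hf : IsNewformOf W f) (hg : IsNewformOf (W.quadraticTwist (d : ℚ)) g) (h64 : 64 ∣ N)
    (h64' : 64 ∣ N') : N' = N := by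
  obtain ⟨h1, h2⟩ := hf.level_dvd_lcm_sixtyfour_of_quadraticTwist hd hg
  rw [Nat.lcm_eq_left h64'] at h1
  rw [Nat.lcm_eq_left h64] at h2
  exact Nat.dvd_antisymm h2 h1

/-- Transport of a newform along an equality of levels. [folklore] -/
theorem exists_isNewformOf_of_level_eq {W' : WeierstrassCurve ℚ} (h : N' = N) (g : CuspForm (Gamma0 N') 2)
    (hg : IsNewformOf W' g) : ∃ g' : CuspForm (Gamma0 N) 2, IsNewformOf W' g' := by
  subst h
  exact ⟨g, hg⟩

/-- The `2`-adic valuation window: `64 ∣ 2ᵗM`, `256 ∤ 2ᵗM` with `M` odd force `6 ≤ t ≤ 7`. [folklore] -/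
theorem six_le_and_le_seven {t M : ℕ} (hMo : Odd M) (h64 : 64 ∣ 2 ^ t * M) (h256 : ¬ 2 ^ 8 ∣ 2 ^ t * M) :
    6 ≤ t ∧ t ≤ 7 := by
  constructor
  · by_contra h
    have hcop : Nat.Coprime (2 ^ 6) M := (Nat.coprime_two_left.mpr hMo).pow_left 6
    have h64' : 2 ^ 6 ∣ 2 ^ t * M := by simpa using h64
    have := (Nat.Coprime.dvd_mul_right hcop).mp h64'
    have := Nat.pow_dvd_pow_iff_le_right (by norm_num : 1 < 2) |>.mp this
    omega
  · by_contra h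
    obtain ⟨k, rfl⟩ := Nat.exists_eq_add_of_le (by omega : 8 ≤ t)
    exact h256 ⟨2 ^ k * M, by rw [pow_add]; ring⟩

/-- **Mai–Murty's `(f, f) ≪ N (log N)³` for every elliptic curve over `ℚ` whose conductor has squarefree
odd part and is not divisible by `2⁸`, from the Modularity Theorem** (`exists_isNewformOf`). There is an
absolute `C > 0` with `Re (f, f)_{Γ₀(N)} ≤ C · N · (1 + log N)³` for the newform `f ∈ S₂(Γ₀(N))` of every
such `E` (`N` any level carrying `IsNewformOf E f`, i.e. the conductor). Dichotomy: if `64 ∤ N` or some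
twist `E^{(d)}`, `d ∈ {−1, 2, −2}`, has `64 ∤ N_{E^{(d)}}`, this is the twist descent
`exists_petersson_le_mul_log_cube_of_exists_isNewformOf`; otherwise all four levels are divisible by `64`,
hence EQUAL (`IsNewformOf.level_eq_of_sixtyfour_dvd_of_quadraticTwist`), `N = 2ᵗM` with `t ∈ {6, 7}`, and
`exists_petersson_le_mul_log_cube_of_two_pow_mul_seven` applies to `f` and the newforms of the three
twists supplied by modularity. Only `v₂(N) = 8` (where the cusps `u/16` need the twists of `f` by the
characters of conductor `16`, which carry the nebentypus `χ₈`) is left out of the conductors with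
squarefree odd part. [cite: MaiMurty1994, §2, Proposition] [cite: AtkinLi1978, §3]
[cite: BreuilConradDiamondTaylor2001, Thm. A] -/
theorem exists_petersson_le_mul_log_cube_of_not_two_pow_eight_dvd (hmod : exists_isNewformOf) :
    ∃ C : ℝ, 0 < C ∧ ∀ (N : ℕ) [NeZero N] (W : WeierstrassCurve ℚ) [W.IsElliptic]
      (f : CuspForm (Gamma0 N) 2), IsNewformOf W f →
      (∀ p : ℕ, p.Prime → p ≠ 2 → ¬ p ^ 2 ∣ N) → ¬ 2 ^ 8 ∣ N →
      (peterssonProduct (Gamma0 N) 2 f f).re ≤ C * N * (1 + Real.log N) ^ 3 := by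
  obtain ⟨C₁, hC₁, h₁⟩ := exists_petersson_le_mul_log_cube_of_exists_isNewformOf hmod
  obtain ⟨C₂, hC₂, h₂⟩ := exists_petersson_le_mul_log_cube_of_two_pow_mul_seven
  refine ⟨max C₁ C₂, lt_max_of_lt_left hC₁, ?_⟩
  intro N _ W _ f hf hodd h256
  have hN1 : (1 : ℝ) ≤ N := by exact_mod_cast NeZero.one_le (n := N)
  have hfac : 0 ≤ (N : ℝ) * (1 + Real.log N) ^ 3 := by
    have := Real.log_nonneg hN1
    positivity
  by_cases hcase : ¬ 64 ∣ N ∨ ∃ d : ℤ, (d = -1 ∨ d = 2 ∨ d = -2) ∧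
      ¬ 64 ∣ (W.quadraticTwist (d : ℚ)).conductorNorm ℤ
  · calc (peterssonProduct (Gamma0 N) 2 f f).re ≤ C₁ * N * (1 + Real.log N) ^ 3 :=
          h₁ N W f hf hodd hcase
      _ = C₁ * (N * (1 + Real.log N) ^ 3) := by ring
      _ ≤ max C₁ C₂ * (N * (1 + Real.log N) ^ 3) := mul_le_mul_of_nonneg_right (le_max_left _ _) hfac
      _ = max C₁ C₂ * N * (1 + Real.log N) ^ 3 := by ring
  · push Not at hcase
    obtain ⟨h64, hall⟩ := hcase
    -- the newforms of the three twists, at level `N`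
    have key : ∀ d : ℤ, (d = -1 ∨ d = 2 ∨ d = -2) →
        ∃ g : CuspForm (Gamma0 N) 2, IsNewformOf (W.quadraticTwist (d : ℚ)) g := by
      intro d hd
      haveI := W.isElliptic_quadraticTwist (ratCast_ne_zero_of_mem hd)
      haveI : NeZero ((W.quadraticTwist (d : ℚ)).conductorNorm ℤ) :=
        ⟨(WeierstrassCurve.conductorNorm_pos_holds (W.quadraticTwist (d : ℚ))).ne'⟩
      obtain ⟨g, hg⟩ := hmod (W.quadraticTwist (d : ℚ))
      exact exists_isNewformOf_of_level_eq
        (hf.level_eq_of_sixtyfour_dvd_of_quadraticTwist hd hg h64 (hall d hd)) g hg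
    obtain ⟨g₁, hg₁⟩ := key (-1) (Or.inl rfl)
    obtain ⟨g₂, hg₂⟩ := key 2 (Or.inr (Or.inl rfl))
    obtain ⟨g₃, hg₃⟩ := key (-2) (Or.inr (Or.inr rfl))
    rw [show ((-1 : ℤ) : ℚ) = -1 by norm_num] at hg₁
    rw [show ((2 : ℤ) : ℚ) = 2 by norm_num] at hg₂
    rw [show ((-2 : ℤ) : ℚ) = -2 by norm_num] at hg₃
    -- `N = 2ᵗ M`, `M` odd squarefree, `6 ≤ t ≤ 7`
    obtain ⟨t, M, hMo, hNtM⟩ := Nat.exists_eq_two_pow_mul_odd (NeZero.ne N)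
    subst hNtM
    haveI : NeZero M := ⟨fun h ↦ by rw [h] at hMo; exact (Nat.not_even_iff_odd.mpr hMo) (Even.zero)⟩
    have hMs : Squarefree M := by
      refine Nat.squarefree_iff_prime_squarefree.mpr fun p hp hpp ↦ ?_
      have hp2 : p ≠ 2 := by
        rintro rfl
        exact (Nat.not_even_iff_odd.mpr hMo) (even_iff_two_dvd.mpr ((dvd_mul_right 2 2).trans hpp))
      exact hodd p hp hp2 (by rw [sq]; exact hpp.trans (Dvd.intro_left _ rfl))
    obtain ⟨ht6, ht7⟩ := six_le_and_le_seven hMo h64 h256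
    calc (peterssonProduct (Gamma0 (2 ^ t * M)) 2 f f).re
        ≤ C₂ * (2 ^ t * M : ℕ) * (1 + Real.log (2 ^ t * M : ℕ)) ^ 3 :=
          h₂ t M (by omega) ht7 hMo hMs W f g₁ g₂ g₃ hf hg₁ hg₂ hg₃
      _ = C₂ * ((2 ^ t * M : ℕ) * (1 + Real.log (2 ^ t * M : ℕ)) ^ 3) := by ring
      _ ≤ max C₁ C₂ * ((2 ^ t * M : ℕ) * (1 + Real.log (2 ^ t * M : ℕ)) ^ 3) :=
          mul_le_mul_of_nonneg_right (le_max_right _ _) hfac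
      _ = max C₁ C₂ * (2 ^ t * M : ℕ) * (1 + Real.log (2 ^ t * M : ℕ)) ^ 3 := by ring

/-- **Power form**: `Re (f, f) ≤ C · N^{1+ε}/ε³` for `0 < ε ≤ 1` under the hypotheses of
`exists_petersson_le_mul_log_cube_of_not_two_pow_eight_dvd`. [cite: MaiMurty1994, §2, Proposition] -/
theorem exists_petersson_le_mul_rpow_of_not_two_pow_eight_dvd (hmod : exists_isNewformOf) :
    ∃ C : ℝ, 0 < C ∧ ∀ ε : ℝ, 0 < ε → ε ≤ 1 → ∀ (N : ℕ) [NeZero N] (W : WeierstrassCurve ℚ) [W.IsElliptic]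
      (f : CuspForm (Gamma0 N) 2), IsNewformOf W f →
      (∀ p : ℕ, p.Prime → p ≠ 2 → ¬ p ^ 2 ∣ N) → ¬ 2 ^ 8 ∣ N →
      (peterssonProduct (Gamma0 N) 2 f f).re ≤ C * (N : ℝ) ^ (1 + ε) / ε ^ 3 := by
  obtain ⟨C, hC, hmain⟩ := exists_petersson_le_mul_log_cube_of_not_two_pow_eight_dvd hmod
  refine ⟨C * 4 ^ 3, by positivity, ?_⟩
  intro ε hε hε1 N _ W _ f hf hodd h256
  have hN1 : (1 : ℝ) ≤ N := by exact_mod_cast NeZero.one_le (n := N)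
  calc (peterssonProduct (Gamma0 N) 2 f f).re ≤ C * N * (1 + Real.log N) ^ 3 :=
        hmain N W f hf hodd h256
    _ = C * (N * (1 + Real.log N) ^ 3) := by ring
    _ ≤ C * (4 ^ 3 * (N : ℝ) ^ (1 + ε) / ε ^ 3) :=
        mul_le_mul_of_nonneg_left (mul_one_add_log_pow_three_le_rpow hN1 hε hε1) hC.le
    _ = C * 4 ^ 3 * (N : ℝ) ^ (1 + ε) / ε ^ 3 := by ring

/-- **`ε`-form** (the shape `∀ ε > 0, ∃ C_ε, Re (f, f) ≤ C_ε · N^{1+ε}` in which the `abc` routes consume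
the Petersson bound). [cite: MaiMurty1994, §2, Proposition] -/
theorem exists_petersson_le_mul_rpow_of_not_two_pow_eight_dvd' (hmod : exists_isNewformOf) {ε : ℝ}
    (hε : 0 < ε) :
    ∃ C : ℝ, 0 < C ∧ ∀ (N : ℕ) [NeZero N] (W : WeierstrassCurve ℚ) [W.IsElliptic]
      (f : CuspForm (Gamma0 N) 2), IsNewformOf W f →
      (∀ p : ℕ, p.Prime → p ≠ 2 → ¬ p ^ 2 ∣ N) → ¬ 2 ^ 8 ∣ N →
      (peterssonProduct (Gamma0 N) 2 f f).re ≤ C * (N : ℝ) ^ (1 + ε) := by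
  obtain ⟨C, hC, h⟩ := exists_petersson_le_mul_rpow_of_not_two_pow_eight_dvd hmod
  set δ : ℝ := min ε 1 with hδ
  have hδ0 : 0 < δ := lt_min hε one_pos
  have hδ1 : δ ≤ 1 := min_le_right _ _
  have hδε : δ ≤ ε := min_le_left _ _
  refine ⟨C / δ ^ 3, by positivity, fun N _ W _ f hf hodd h256 ↦ ?_⟩
  have hN1 : (1 : ℝ) ≤ N := by exact_mod_cast NeZero.one_le (n := N)
  calc (peterssonProduct (Gamma0 N) 2 f f).re ≤ C * (N : ℝ) ^ (1 + δ) / δ ^ 3 :=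
        h δ hδ0 hδ1 N W f hf hodd h256
    _ ≤ C * (N : ℝ) ^ (1 + ε) / δ ^ 3 := by gcongr
    _ = C / δ ^ 3 * (N : ℝ) ^ (1 + ε) := by ring

/-- **Logarithmic form**: `log Re (f, f) ≤ log N + 3 log (1 + log N) + C` — Pasten's use of the named fact
(arXiv:1705.09251, §16 p. 49: "`2 log ‖f‖ ≤ log N + O(log log N)`") — for every curve with squarefree odd
conductor and `256 ∤ N`. [cite: PastenShimura2024, §16 p. 49] [cite: MaiMurty1994, §2, Proposition] -/
theorem exists_log_petersson_le_of_not_two_pow_eight_dvd (hmod : exists_isNewformOf) :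
    ∃ C : ℝ, ∀ (N : ℕ) [NeZero N] (W : WeierstrassCurve ℚ) [W.IsElliptic]
      (f : CuspForm (Gamma0 N) 2), IsNewformOf W f →
      (∀ p : ℕ, p.Prime → p ≠ 2 → ¬ p ^ 2 ∣ N) → ¬ 2 ^ 8 ∣ N →
      Real.log (peterssonProduct (Gamma0 N) 2 f f).re ≤
        Real.log N + 3 * Real.log (1 + Real.log N) + C := by
  obtain ⟨C, hC, hmain⟩ := exists_petersson_le_mul_log_cube_of_not_two_pow_eight_dvd hmod
  refine ⟨Real.log C, fun N _ W _ f hf hodd h256 ↦ ?_⟩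
  have hN0 : (0 : ℝ) < N := Nat.cast_pos.mpr (NeZero.pos N)
  have hN1 : (1 : ℝ) ≤ N := by exact_mod_cast NeZero.one_le (n := N)
  have hl : 0 < 1 + Real.log N := by
    have := Real.log_nonneg hN1
    linarith
  have hpos : 0 < (peterssonProduct (Gamma0 N) 2 f f).re := hf.peterssonProduct_re_pos
  have hb := hmain N W f hf hodd h256
  calc Real.log (peterssonProduct (Gamma0 N) 2 f f).re
      ≤ Real.log (C * N * (1 + Real.log N) ^ 3) := Real.log_le_log hpos hb
    _ = Real.log N + 3 * Real.log (1 + Real.log N) + Real.log C := by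
        rw [Real.log_mul (by positivity) (by positivity), Real.log_mul hC.ne' hN0.ne',
          Real.log_pow]
        push_cast
        ring

/-- **The same bound phrased on the conductor** (the hypotheses of the `abc` routes: `p² ∤ N_E` for odd
`p`, plus `2⁸ ∤ N_E`): for the newform `f ∈ S₂(Γ₀(N))` of `E` one has `N = N_E`
(`IsNewformOf.level_eq_conductorNorm_of_exists_isNewformOf`, under modularity), so
`Re (f, f)_{Γ₀(N)} ≤ C · N · (1 + log N)³`. Every Frey–Hellegouarch and every semistable curve is covered
(`v₂(N_E) ≤ 5`), as is every curve with `v₂(N_E) ∈ {6, 7}`. [cite: MaiMurty1994, §2, Proposition]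
[cite: BreuilConradDiamondTaylor2001, Thm. A] -/
theorem exists_petersson_le_mul_log_cube_of_conductorNorm_not_two_pow_eight_dvd (hmod : exists_isNewformOf) :
    ∃ C : ℝ, 0 < C ∧ ∀ (N : ℕ) [NeZero N] (W : WeierstrassCurve ℚ) [W.IsElliptic]
      (f : CuspForm (Gamma0 N) 2), IsNewformOf W f →
      (∀ p : ℕ, p.Prime → p ≠ 2 → ¬ p ^ 2 ∣ W.conductorNorm ℤ) → ¬ 2 ^ 8 ∣ W.conductorNorm ℤ →
      (peterssonProduct (Gamma0 N) 2 f f).re ≤ C * N * (1 + Real.log N) ^ 3 := by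
  obtain ⟨C, hC, h⟩ := exists_petersson_le_mul_log_cube_of_not_two_pow_eight_dvd hmod
  refine ⟨C, hC, fun N _ W _ f hf hodd h256 ↦ ?_⟩
  have hNeq : N = W.conductorNorm ℤ := hf.level_eq_conductorNorm_of_exists_isNewformOf hmod
  exact h N W f hf (by rw [hNeq]; exact hodd) (by rw [hNeq]; exact h256)

/-- **`ε`-form on the conductor class** `p² ∤ N_E` (`p` odd), `2⁸ ∤ N_E`.
[cite: MaiMurty1994, §2, Proposition] -/
theorem exists_petersson_le_mul_rpow_of_conductorNorm_not_two_pow_eight_dvd (hmod : exists_isNewformOf)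
    {ε : ℝ} (hε : 0 < ε) :
    ∃ C : ℝ, 0 < C ∧ ∀ (N : ℕ) [NeZero N] (W : WeierstrassCurve ℚ) [W.IsElliptic]
      (f : CuspForm (Gamma0 N) 2), IsNewformOf W f →
      (∀ p : ℕ, p.Prime → p ≠ 2 → ¬ p ^ 2 ∣ W.conductorNorm ℤ) → ¬ 2 ^ 8 ∣ W.conductorNorm ℤ →
      (peterssonProduct (Gamma0 N) 2 f f).re ≤ C * (N : ℝ) ^ (1 + ε) := by
  obtain ⟨C, hC, h⟩ := exists_petersson_le_mul_rpow_of_not_two_pow_eight_dvd' hmod hε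
  refine ⟨C, hC, fun N _ W _ f hf hodd h256 ↦ ?_⟩
  have hNeq : N = W.conductorNorm ℤ := hf.level_eq_conductorNorm_of_exists_isNewformOf hmod
  exact h N W f hf (by rw [hNeq]; exact hodd) (by rw [hNeq]; exact h256)

end TwistStable

end Literature.NumberTheory.Automorphic
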